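import Literature.AlgebraicGeometry.Shioda1982.PicardNumber
import HarnessLib

/-!
# Shioda 1982: the indecomposable elements of `𝔅²ₘ` at prime-power levels (Theorem 6 (b), (c)), the Picard number of the Fermat surfaces of degree `3ⁿ` and `2ⁿ` (Theorem 8), and the Hodge sextuples of level `5ⁿ` (Shioda 1981, Appendix)

Topic `Literature/AlgebraicGeometry/Shioda1982`. THEOREMS (no named fact, no `sorry`) continuing `PicardNumber.lean`
(formula (3) and Theorem 7 of the same paper) with the prime-power levels: T. Shioda, *On the Picard number of a Fermat
surface*, J. Fac. Sci. Univ. Tokyo IA **28** (1982) 725–734 (page images read: `run/shared/lean/pub/pub-hfermat/lit/scans/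
Shioda1982/page02.png` = p. 726, `page04.png` = p. 728, `page07.png` = p. 731, `page08.png` = p. 732), in the vocabulary of
`FermatCharacter.IsHodge` (`α ∈ 𝔅²ₘ`) and of the `p`-standard multisets `σ_{p,c}` of `HodgeTheory.FermatHodgeCharactersPrimePow`.

* [p. 726, §2] `𝔇²ₘ` / `𝔍²ₘ` = the decomposable / indecomposable elements of `𝔅²ₘ` (`aᵢ + aⱼ ≡ 0` for some / no `i ≠ j`).
  HERE: `indecomposableQuadruples m` and **`card_hodgeQuadruples_eq_add`**: `|𝔅²ₘ| = |𝔇²ₘ| + |𝔍²ₘ|`.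
* [p. 728, §4] "**Lemma 1.** (a) Suppose `m = 2m′` is even, and set `αᵢ = (i, m′ + i, m − 2i, m′)` …, `βᵢ = (i, m′ + i, m′ + 2i, m − 4i)`
  … (b) Suppose `m = 3m″`, and let `γⱼ = (j, m″ + j, 2m″ + j, m − 3j)` …. Then [these] are indecomposable elements of `𝔅²ₘ` …"
  HERE (prime-power levels, arbitrary residue as index): `alphaStd c = (c, d + c, −2c, d)`, `betaStd c = (c, d + c, d + 2c, −4c)`
  (`m = 2ᵏ`, `d = m/2`), `gammaStd c = (c, d + c, 2d + c, −3c)` (`m = 3ᵏ`, `d = m/3`); their multisets of values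
  (`univ_val_map_alphaStd` = Aoki's `σ_{2,c}`, `univ_val_map_betaStd`, `univ_val_map_gammaStd` = `σ_{3,c}`); they are Hodge
  (`isHodge_alphaStd`, `isHodge_betaStd` — via `β_c + {±2c} + {d, d} ∼ σ_{2,c} ∗ σ_{2,2c}` —, `isHodge_gammaStd`) and
  indecomposable (`alphaStd_add_ne_zero` for `2c ∉ {0, d}`, `betaStd_add_ne_zero` for `4c ≠ 0`, `gammaStd_add_ne_zero` for `3c ≠ 0`).
* [p. 731] "**Theorem 6.** … (b) If `m = 3ⁿ` (`n ≥ 2`), then any indecomposable element `α` of `𝔅²ₘ` with `GCD(α) = 1` (i.e. any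
  element of `𝔍²ₘ(1)`) is a permutation of one of `γⱼ` (`1 ≤ j ≤ m/3`, `(j, 3) = 1`) of Lemma 1. (c) If `m = 2ⁿ` (`n ≥ 4`), then any
  element of `𝔍²ₘ(1)` is a permutation of one of `αᵢ` or `βᵢ` (`1 ≤ i ≤ m/2`, `i`: odd) of Lemma 1."
  HERE, for EVERY `k ≥ 1` and without the primitivity proviso (non-primitive indecomposables are the multiples of standard
  elements of lower level, which are again of the displayed shape): **`exists_perm_gammaStd`** / **`indecomposable_iff_three_pow`**
  (`m = 3ᵏ`: the indecomposable `α ∈ 𝔅²ₘ` are exactly the permutations of the `γ_c`, `3c ≠ 0`), **`exists_perm_gammaStd_lt`**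
  (the printed normalisation for `GCD(α) = 1`: `1 ≤ j < m/3`, `3 ∤ j`), **`exists_perm_alphaStd_or_betaStd`** /
  **`indecomposable_iff_two_pow`** (`m = 2ᵏ`: exactly the permutations of the `α_c`, `2c ∉ {0, d}`, and of the `β_c`,
  `4c ∉ {0, d}`); multiset forms `map_eq_std_of_indecomposable(_two)`.
* [p. 732] "**Theorem 8.** (i) If `m = 2ⁿ`, then `ρ(X²ₘ) = 3(m−1)(m−2) + 2 + 24(m−6)` (`n ≥ 3`) (`= 20` if `n = 2` and `= 2` if
  `n = 1`). (ii) If `m = 3ⁿ`, then `ρ(X²ₘ) = 3(m−1)(m−2) + 1 + 8(m−3)`."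
  HERE the combinatorial content `ρ − 1 = |𝔅²ₘ|` ((1) p. 725, Lefschetz — the geometric step is NOT formalised, as in
  `PicardNumber.lean`): **`card_hodgeQuadruples_two_pow`** (`k ≥ 3`), `card_hodgeQuadruples_two_and_four` (`k = 1, 2` by
  evaluation), **`card_hodgeQuadruples_three_pow`** (all `k ≥ 1`), and the counts of indecomposables
  `card_indecomposableQuadruples_two_pow` (`= 24(m − 6)`), `card_indecomposableQuadruples_three_pow` (`= 24(m/3 − 1) = 8(m − 3)`).

* [Shioda 1981, Math. Ann. 258, Appendix (A.1), pp. 78–79] "`γᵢ = (i, i+5, i+10, i+15, i+20, 25−5i)` (`i = 1,2,3,4`) … the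
  set `𝔅⁴₂₅` has `4·6!` indecomposable elements which are permutations of `γᵢ` (`1 ≤ i ≤ 4`) and `182400` decomposable elements."
  HERE (section `FivePow`, every level `5ᵏ`): `fiveStd c = (c, d+c, 2d+c, 3d+c, 4d+c, −5c)` (`d = m/5`; multiset = Aoki's `σ_{5,c}`),
  `isHodge_fiveStd`, **`isPaired_or_exists_perm_fiveStd`** / `not_isPaired_iff_five_pow` (a Hodge sextuple of level `5ᵏ` is paired —
  a juxtaposition of three `(a, −a)` — or a permutation of a `γ_c`, `5c ≠ 0`, and not both), `card_hodge_not_paired_five_pow`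
  (`6!·(m/5 − 1)` non-paired elements of `𝔅⁴ₘ`) and **`card_hodge_not_paired_twentyfive`** (`= 4·6! = 2880` at `m = 25`, as printed;
  the count `182400` of the paired ones is not formalised).
* The common source of the `3ᵏ` and `5ᵏ` statements (section `PrimePowCount`): **`eq_pStandard_of_not_symmetric`** — at
  level `pᵏ`, `p` an odd prime, a Hodge multiset of cardinality `p + 1` with non-symmetric multiplicities IS a standard multiset `σ_{p,c}`,
  `pc ≠ 0` — and **`card_hodge_not_symmetric_prime_pow`** (`(p+1)!·(m/p − 1)` Hodge `(p+1)`-tuples with non-symmetric multiplicities).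
  Printed instances: `p = 3` (Shioda 1982 Thm 6 (b), (5), Thm 8 (ii)) and `m = 25` (Shioda 1981 Appendix); the statements uniform in
  `p`, `k` are this formalisation's (same proof), recorded here because both printed theorems are their instances.

## The proof (NOT Shioda's)

Shioda derives Theorem 6 from Koblitz–Rohrlich's classification of the relations `H_β = H_γ` for Fermat CURVES at levels `3ⁿ`,
`2ⁿ` (Thm K-R (b₁), (c₁)) through the inductive structure (Prop. 5); that classification is not in the tree. Here instead
(sections `PrimePow`, `ThreePow`, `TwoPow`): by the tree's PROVED `IsHodgeMultiset.exists_odd_countSub_eq` and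
`integral_of_odd_eq` (Koblitz–Ogus at level `pᵏ` with Aoki's level-lowering, file `FermatHodgeCharactersPrimePow`) the odd part of
the multiplicity function of a Hodge multiset `s` is `x ↦ b(px) − b(x)` for an odd INTEGRAL `b` supported on `pℤ/pᵏ`. Take `w` in
the support of `b` of minimal `p`-adic valuation with `b(w) > 0`; the `p` residues `y` with `py = w` lie outside the support, so
each occurs in `s` at least `b(w)` times. For `p` odd and `#s = p + 1` this forces `s = {c + i d} + {z}` (`pc = w`) and Shioda's
congruence `Σ s = 0` gives `z = −pc`: `s = σ_{p,c}` (`eq_pStandard_of_not_symmetric`; at `p = 3` this is Theorem 6 (b) — an indecomposable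
`α` is not negation-symmetric because `m` is odd). For `p = 2` and `#s = 4`: `b(w) = 1` (else `s = 2{c, c+d}` has `Σ s = 2w ≠ 0`);
if `b(2w) ≤ 0` then `−w ∈ s` and `s = {c, c + d, −2c, d}` (type `α`); if `b(2w) > 0 ≥ b(w + d)` then `w + d ∈ s` and
`s = {c, c + d, 2c + d, −4c}` (type `β`); `b(2w), b(w + d) > 0` is impossible (the residues over `w` and `w + d` would exhaust
`s`, and `Σ s = 2w + d ≠ 0`). The counts: an injective parametrisation of the standard multisets by `w = 3c ∈ 3ℤ/3ᵏ ∖ {0}`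
(`m/3 − 1` of them), resp. `w = 2c ∈ 2ℤ/2ᵏ ∖ {0, d}` (`m/2 − 2`, type `α`) and `w ∈ 2ℤ/2ᵏ` with `2w ∉ {0, d}` (`m/2 − 4`,
type `β`, `k ≥ 3`), each multiset duplicate-free with `4! = 24` orderings; plus `|𝔇²ₘ|` from formula (3) (`card_decomposableQuadruples`).

## Cross-checks

Kernel evaluation (`decide +kernel`) of `|𝔅²₈| = 175` and `|𝔅²₉| = 216` against the closed formulas (examples below; `PicardNumber.lean`
has `m = 8, 9` too); instances `|𝔅²₁₆| = 871`, `|𝔅²₃₂| = 3415`, `|𝔅²₂₇| = 2142`, `|𝔅²₈₁| = 19584` from the theorems. Outside Lean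
(cell `pub-hfermat`, `code/lit/picard/table_vs_thm8.py`): the formulas agree with the two-implementation enumeration
(`data/hodge_fermat_n2.json`, column `rank` = `|𝔅²ₘ| + 1`) at all eleven prime-power levels `m ≤ 300` (`8, 16, …, 256; 3, 9, …, 243`)
and with a brute-force count of `𝔅²ₘ` for `m ≤ 32`; `0` disagreements. `code/lit/picard/table_vs_fivepow.py`: `6!·(m/5 − 1)` = the
fourfold table's count of `σ_{5,i}`-classes (`data/hodge_fermat_n4.json`, grade E1) at `m = 25` (`2880`; grade E0 = `182400`, Shioda's
printed count of the decomposable ones) and `m = 125` (`17280`), and = a brute-force count of the non-symmetric Hodge sextuples at `m = 25`.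

Printed normalisations for primitive elements (`GCD(α) = 1`): `exists_perm_gammaStd_lt` (`1 ≤ j < m/3`, `3 ∤ j`) and
`exists_perm_alphaStd_or_betaStd_lt` (`1 ≤ i < m/2`, `i` odd). Not treated: the geometric statements ((1), lines spanning `NS`),
Theorem K-R and Prop. 5, the function `g(m)` and formulas (5)/(9) for general `m`, the count `182400` of paired sextuples at `m = 25`.

HONEST FRAMING (cell `pub-hfermat`): explicit algebraic cycles for specific Hodge classes on Fermat/Delsarte varieties; residual open
instances listed; no claim on general Hodge. (Surface classes are algebraic by Lefschetz (1,1); this file reproduces printed structure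
theorems and counts.)

## References
* [Shioda1982PicardFermat] T. Shioda, *On the Picard number of a Fermat surface*, J. Fac. Sci. Univ. Tokyo IA 28 (1982) 725–734:
  §2 p. 726, Lemma 1 p. 728, Thm 6 p. 731, Thm 8 p. 732 (page images read).
* [AokiShioda1983] N. Aoki, T. Shioda, *Generators of the Néron–Severi group of a Fermat surface*, Progr. Math. 35 (1983) 1–12, §2
  Thm `(𝔅²ₘ)` (the standard elements `αᵢ, βᵢ, γⱼ` at general level; the tree's named facts `AokiShioda1983_thmB2m_*`).
* [Shioda1981FermatType] T. Shioda, *Algebraic Cycles on Abelian Varieties of Fermat Type*, Math. Ann. 258 (1981) 65–80, Appendix (A.1)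
  and p. 79 (GDZ scan read; transcript `run/shared/lean/pub/pub-hfermat/lit/Shioda1981-MathAnn258.md`).
* [Aoki1987] N. Aoki, J. Math. Soc. Japan 39 (1987) 385–396, §1 (`σ_{p,i}`), Thm 1-2 (the tree's `FermatHodgeCharactersPrimePow`).
-/

namespace Literature.AlgebraicGeometry.Shioda1982

open Finset Multiset
open Literature.AlgebraicGeometry.HodgeTheory Literature.AlgebraicGeometry.HodgeTheory.FermatCharacter

section PrimePow

variable {p k : ℕ}

/-- The representative of `p x` in `ℤ/pᵏ` is divisible by `p` (`p ∣ pᵏ`). [folklore] -/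
private theorem dvd_val_p_mul (hp : p.Prime) (hk : 0 < k) (x : ZMod (p ^ k)) :
    p ∣ ((p : ZMod (p ^ k)) * x).val := by
  haveI : NeZero (p ^ k) := ⟨pow_ne_zero _ hp.ne_zero⟩
  have hpx : ((p : ZMod (p ^ k)) * x).val = (p * x.val) % p ^ k := by
    rw [← ZMod.natCast_zmod_val x, ← Nat.cast_mul, ZMod.val_natCast, ZMod.natCast_zmod_val]
  rw [hpx]
  exact (Nat.dvd_mod_iff (dvd_pow_self p hk.ne')).mpr (dvd_mul_right p _)

/-- **The odd part of the multiplicity function is `T` of an integral odd function supported on `pℤ/pᵏ`.**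
For a Hodge multiset `s` over `ℤ/pᵏ` (`k ≥ 1`) there is `b : ℤ/pᵏ → ℤ`, odd, vanishing off `pℤ/pᵏ`, with
`#ₓ s − #₋ₓ s = b(px) − b(x)` for every `x` (Koblitz–Ogus via the tree's `exists_odd_countSub_eq`, made
integral by `integral_of_odd_eq` and extended by `0` off `pℤ/pᵏ`). [folklore] -/
private theorem exists_int_odd (hp : p.Prime) (hk : 0 < k) {s : Multiset (ZMod (p ^ k))} (hs : IsHodgeMultiset s) :
    ∃ b : ZMod (p ^ k) → ℤ, (∀ w, b (-w) = -b w) ∧ (∀ w, b w ≠ 0 → p ∣ w.val) ∧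
      ∀ x : ZMod (p ^ k), ((count x s : ℤ) - count (-x) s) = b ((p : ZMod (p ^ k)) * x) - b x := by
  haveI : NeZero (p ^ k) := ⟨pow_ne_zero _ hp.ne_zero⟩
  obtain ⟨a, hodd, ha⟩ := hs.exists_odd_countSub_eq hp hk
  have hT : ∀ x : ZMod (p ^ k), (((count x s : ℤ) - count (-x) s : ℤ) : ℚ) =
      a ((p : ZMod (p ^ k)) * x) - (if p ∣ x.val then a x else 0) := fun x ↦ by
    push_cast
    exact ha x
  have H := integral_of_odd_eq hp hodd hT
  classical
  let b : ZMod (p ^ k) → ℤ := fun w ↦ if h : p ∣ w.val then (H w h).choose else 0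
  have hb : ∀ w, p ∣ w.val → (b w : ℚ) = a w := fun w h ↦ by
    simp only [b, dif_pos h]
    exact (H w h).choose_spec.symm
  have hb0 : ∀ w, ¬ p ∣ w.val → b w = 0 := fun w h ↦ by
    simp only [b, dif_neg h]
  refine ⟨b, fun w ↦ ?_, fun w h ↦ ?_, fun x ↦ ?_⟩
  · by_cases h : p ∣ w.val
    · have h' : p ∣ (-w).val := (dvd_val_neg_iff hp hk w).mpr h
      have e : ((b (-w) : ℤ) : ℚ) = ((-b w : ℤ) : ℚ) := by
        rw [hb _ h', Int.cast_neg, hb _ h, hodd]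
      exact_mod_cast e
    · have h' : ¬ p ∣ (-w).val := (dvd_val_neg_iff hp hk w).not.mpr h
      rw [hb0 _ h, hb0 _ h', neg_zero]
  · by_contra hw
    exact h (hb0 w hw)
  · have e : (((count x s : ℤ) - count (-x) s : ℤ) : ℚ) = ((b ((p : ZMod (p ^ k)) * x) - b x : ℤ) : ℚ) := by
      rw [hT x, Int.cast_sub, hb _ (dvd_val_p_mul hp hk x)]
      by_cases h : p ∣ x.val
      · rw [if_pos h, hb _ h]
      · rw [if_neg h, hb0 _ h, Int.cast_zero]
    exact_mod_cast e

/-- **A deepest element of the support.** If `b : ℤ/pᵏ → ℤ` vanishes at `0` and is not identically zero, there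
are `v` and `w` with `b w ≠ 0`, `p^{v+1} ∤ ⟨w⟩`, and `p^v ∣ ⟨x⟩` for every `x` with `b x ≠ 0` (take `v` least
such that some element of the support has valuation `≤ v`). [folklore] -/
private theorem exists_deepest (hp : p.Prime) {b : ZMod (p ^ k) → ℤ} (h0 : b 0 = 0) (hb : ∃ x, b x ≠ 0) :
    ∃ v : ℕ, ∃ w : ZMod (p ^ k), b w ≠ 0 ∧ ¬ p ^ (v + 1) ∣ w.val ∧ ∀ x, b x ≠ 0 → p ^ v ∣ x.val := by
  haveI : NeZero (p ^ k) := ⟨pow_ne_zero _ hp.ne_zero⟩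
  classical
  have hP : ∃ v, ∃ w : ZMod (p ^ k), b w ≠ 0 ∧ ¬ p ^ (v + 1) ∣ w.val := by
    obtain ⟨x, hx⟩ := hb
    refine ⟨k, x, hx, fun h ↦ ?_⟩
    have hx0 : x.val ≠ 0 := fun h' ↦ hx (by rw [(ZMod.val_eq_zero x).mp h', h0])
    have hlt : x.val < p ^ (k + 1) := (ZMod.val_lt x).trans (Nat.pow_lt_pow_right hp.one_lt (by omega))
    exact hx0 (Nat.eq_zero_of_dvd_of_lt h hlt)
  refine ⟨Nat.find hP, ?_⟩
  obtain ⟨w, hw, hv⟩ := Nat.find_spec hP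
  refine ⟨w, hw, hv, fun x hx ↦ ?_⟩
  rcases Nat.eq_zero_or_pos (Nat.find hP) with h | h
  · rw [h, pow_zero]
    exact one_dvd _
  · have hmin := Nat.find_min hP (Nat.sub_one_lt_of_lt h)
    push Not at hmin
    have := hmin x hx
    rwa [Nat.sub_add_cancel h] at this

/-- The children `y` (`p y = w`) of a deepest element `w` of the support lie outside the support. [folklore] -/
private theorem eq_zero_of_p_mul_eq (hp : p.Prime) {b : ZMod (p ^ k) → ℤ} {v : ℕ} {w : ZMod (p ^ k)}
    (hv : ¬ p ^ (v + 1) ∣ w.val) (hmin : ∀ x, b x ≠ 0 → p ^ v ∣ x.val) (hvk : v < k)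
    {y : ZMod (p ^ k)} (hy : (p : ZMod (p ^ k)) * y = w) : b y = 0 := by
  haveI : NeZero (p ^ k) := ⟨pow_ne_zero _ hp.ne_zero⟩
  by_contra hy0
  have h1 : p ^ (v + 1) ∣ p * y.val := by
    rw [pow_succ']
    exact Nat.mul_dvd_mul_left p (hmin y hy0)
  have hpx : w.val = (p * y.val) % p ^ k := by
    rw [← hy, ← ZMod.natCast_zmod_val y, ← Nat.cast_mul, ZMod.val_natCast, ZMod.natCast_zmod_val]
  apply hv
  rw [hpx]
  exact (Nat.dvd_mod_iff (pow_dvd_pow p hvk)).mpr h1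


/-- A deepest element of the support may be taken with POSITIVE value (replace `w` by `−w`, which has the
same valuation). [folklore] -/
private theorem exists_deepest_pos (hp : p.Prime) {b : ZMod (p ^ k) → ℤ} (hodd : ∀ w, b (-w) = -b w)
    (hb : ∃ x, b x ≠ 0) :
    ∃ v : ℕ, ∃ w : ZMod (p ^ k), 0 < b w ∧ ¬ p ^ (v + 1) ∣ w.val ∧ (∀ x, b x ≠ 0 → p ^ v ∣ x.val) ∧ v < k := by
  haveI : NeZero (p ^ k) := ⟨pow_ne_zero _ hp.ne_zero⟩
  have h0 : b 0 = 0 := by have := hodd 0; rw [neg_zero] at this; omega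
  obtain ⟨v, w, hw, hv, hmin⟩ := exists_deepest hp h0 hb
  have hw0 : w.val ≠ 0 := fun h ↦ hv (h ▸ dvd_zero _)
  have hvk : v < k := by
    have h1 : p ^ v ≤ w.val := Nat.le_of_dvd (Nat.pos_of_ne_zero hw0) (hmin w hw)
    exact (Nat.pow_lt_pow_iff_right hp.one_lt).mp (h1.trans_lt (ZMod.val_lt w))
  rcases lt_or_gt_of_ne hw with hneg | hpos
  · refine ⟨v, -w, by rw [hodd]; omega, fun h ↦ hv ?_, hmin, hvk⟩
    have hw0' : w ≠ 0 := fun h' ↦ hw0 (by rw [h', ZMod.val_zero])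
    rw [ZMod.neg_val, if_neg hw0'] at h
    have hk' : p ^ (v + 1) ∣ p ^ k := pow_dvd_pow p hvk
    exact (Nat.dvd_sub_iff_right (ZMod.val_lt w).le hk').mp h
  · exact ⟨v, w, hpos, hv, hmin, hvk⟩


/-- The progression `{c + i d}_{i<p}` lies below `s` as soon as each of its members occurs in `s`
(it is duplicate-free). [folklore] -/
private theorem prog_le (hp : p.Prime) (hk : 0 < k) {s : Multiset (ZMod (p ^ k))} (c : ZMod (p ^ k))
    (h : ∀ x, (p : ZMod (p ^ k)) * x = (p : ZMod (p ^ k)) * c → 1 ≤ count x s) :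
    (Multiset.range p).map (fun i : ℕ ↦ c + (i : ZMod (p ^ k)) * ((p ^ k / p : ℕ) : ZMod (p ^ k))) ≤ s := by
  classical
  rw [Multiset.le_iff_count]
  intro x
  rw [count_range_map hp hk]
  split_ifs with hx
  · exact h x hx
  · exact Nat.zero_le _

/-- **Classification at odd prime-power level, length `p + 1`.** Let `m = pᵏ` (`p` an odd prime, `k ≥ 1`) and let
`s` be a Hodge multiset over `ℤ/m` with `#s = p + 1` which is not negation-symmetric. Then `s` is a `p`-standard
multiset `σ_{p,c} = {c, c + d, …, c + (p−1)d, −pc}` (`d = m/p`) with `pc ≠ 0`. Printed instances: `p = 3` — Shioda 1982,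
Theorem 6 (b) (the indecomposable elements of `𝔅²_{3ⁿ}` are the permutations of the `γⱼ`); `m = 25` — Shioda 1981, Appendix
(A.1), p. 79: "the set `𝔅⁴₂₅` has `4·6!` indecomposable elements which are permutations of `γᵢ` (`1 ≤ i ≤ 4`)",
`γᵢ = (i, i+5, i+10, i+15, i+20, 25−5i)`. The statement uniform in `p`, `k` and its proof are this formalisation's: let `b` be the
integral odd function with `#ₓs − #₋ₓs = b(px) − b(x)` (`exists_int_odd`, from the tree's Koblitz–Ogus lemmas) and `w` a deepest
element of its support with `b(w) > 0`; the `p` residues `y` with `py = w` lie outside the support, so `#_y s ≥ b(w) ≥ 1` for each: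
`s ⊇ {c + i d}` (`pc = w`), and the remaining entry is `−Σ (c + i d) = −pc` by Shioda's congruence `Σ s = 0`.
[cite: Shioda1982PicardFermat, Thm 6 (b) p. 731] [cite: Shioda1981FermatType, Appendix (A.1), pp. 78–79] -/
theorem eq_pStandard_of_not_symmetric (hp : p.Prime) (hp2 : p ≠ 2) (hk : 0 < k) {s : Multiset (ZMod (p ^ k))}
    (hs : IsHodgeMultiset s) (hcard : card s = p + 1) (hns : ∃ x, count x s ≠ count (-x) s) :
    ∃ c : ZMod (p ^ k), (p : ZMod (p ^ k)) * c ≠ 0 ∧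
      s = (Multiset.range p).map (fun i : ℕ ↦ c + (i : ZMod (p ^ k)) * ((p ^ k / p : ℕ) : ZMod (p ^ k)))
        + {-((p : ZMod (p ^ k)) * c)} := by
  classical
  haveI : NeZero (p ^ k) := ⟨pow_ne_zero _ hp.ne_zero⟩
  obtain ⟨b, hodd, hsupp, hb⟩ := exists_int_odd hp hk hs
  have hb0 : ∃ x, b x ≠ 0 := by
    by_contra h
    push Not at h
    obtain ⟨x, hx⟩ := hns
    have := hb x
    rw [h, h, sub_self, sub_eq_zero] at this
    exact hx (by exact_mod_cast this)
  obtain ⟨v, w, hw, hv, hmin, hvk⟩ := exists_deepest_pos hp hodd hb0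
  -- `w = p c`
  obtain ⟨j, hj⟩ := hsupp w hw.ne'
  set c : ZMod (p ^ k) := (j : ZMod (p ^ k)) with hc
  have hpc : (p : ZMod (p ^ k)) * c = w := by
    rw [hc, ← Nat.cast_mul, ← hj, ZMod.natCast_zmod_val]
  -- the children of `w` occur in `s`
  have hchild : ∀ x, (p : ZMod (p ^ k)) * x = (p : ZMod (p ^ k)) * c → 1 ≤ count x s := by
    intro x hx
    rw [hpc] at hx
    have hx0 : b x = 0 := eq_zero_of_p_mul_eq hp hv hmin hvk hx
    have := hb x
    rw [hx, hx0, sub_zero] at this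
    have : (0 : ℤ) ≤ count (-x) s := by positivity
    omega
  obtain ⟨t, ht⟩ := Multiset.le_iff_exists_add.mp (prog_le hp hk c hchild)
  -- the remaining entry
  have hct : card t = 1 := by
    have := congrArg Multiset.card ht
    rw [Multiset.card_add, Multiset.card_map, Multiset.card_range, hcard] at this
    omega
  obtain ⟨z, rfl⟩ := Multiset.card_eq_one.mp hct
  have hsum := hs.1.2
  have hstd := sum_std hp hk c
  rw [if_neg hp2, add_zero, Multiset.sum_add, Multiset.sum_singleton] at hstd
  rw [ht, Multiset.sum_add, Multiset.sum_singleton] at hsum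
  have hz : z = -((p : ZMod (p ^ k)) * c) := by linear_combination hsum - hstd
  refine ⟨c, ?_, ?_⟩
  · rw [hpc]
    intro h
    have h0 : b 0 = 0 := by have := hodd 0; rw [neg_zero] at this; omega
    rw [h, h0] at hw
    exact lt_irrefl _ hw
  · rw [ht, hz]

end PrimePow

/-! ## Indecomposable elements and how to count them -/

section Counting

variable (m : ℕ) [NeZero m]

/-- **`𝔍²ₘ`**, the indecomposable elements of `𝔅²ₘ`: Hodge characters `α` with `αᵢ + αⱼ ≠ 0` for all `i ≠ j`.
[cite: Shioda1982PicardFermat, §2 p. 726] -/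
def indecomposableQuadruples : Finset (Fin 4 → ZMod m) :=
  (hodgeQuadruples m).filter fun α ↦ ∀ i j : Fin 4, i ≠ j → α i + α j ≠ 0

variable {m}

/-- `α ∈ 𝔍²ₘ` iff `α` is an indecomposable Hodge character. [cite: Shioda1982PicardFermat, §2 p. 726] -/
theorem mem_indecomposableQuadruples {α : Fin 4 → ZMod m} :
    α ∈ indecomposableQuadruples m ↔ IsHodge α ∧ ∀ i j : Fin 4, i ≠ j → α i + α j ≠ 0 := by
  simp [indecomposableQuadruples, hodgeQuadruples]

/-- **`|𝔅²ₘ| = |𝔇²ₘ| + |𝔍²ₘ|`** (`𝔅²ₘ = 𝔇²ₘ ⊔ 𝔍²ₘ`). [cite: Shioda1982PicardFermat, §2 p. 726] -/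
theorem card_hodgeQuadruples_eq_add :
    (hodgeQuadruples m).card = (decomposableQuadruples m).card + (indecomposableQuadruples m).card := by
  classical
  have hD : (hodgeQuadruples m).filter (fun α ↦ ∃ i j : Fin 4, i ≠ j ∧ α i + α j = 0) = decomposableQuadruples m := by
    ext α
    simp only [Finset.mem_filter, hodgeQuadruples, decomposableQuadruples, Finset.mem_univ, true_and]
    constructor
    · rintro ⟨hα, h⟩
      exact ⟨hα.1.1, hα.1.2, h⟩
    · rintro ⟨hne, hsum, h⟩
      have hmem : α ∈ decomposableQuadruples m := by
        simp only [decomposableQuadruples, Finset.mem_filter, Finset.mem_univ, true_and]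
        exact ⟨hne, hsum, h⟩
      have := decomposableQuadruples_subset_hodgeQuadruples hmem
      simp only [hodgeQuadruples, Finset.mem_filter, Finset.mem_univ, true_and] at this
      exact ⟨this, h⟩
  have hI : (hodgeQuadruples m).filter (fun α ↦ ¬ ∃ i j : Fin 4, i ≠ j ∧ α i + α j = 0) =
      indecomposableQuadruples m := by
    refine Finset.filter_congr fun α _ ↦ ?_
    push Not
    rfl
  rw [← hD, ← hI, Finset.card_filter_add_card_filter_not]

/-- Tuples with the same multiset of values differ by a permutation of the indices (the tree's
`HodgeTheory.exists_perm_eq_comp_of_univ_val_map_eq`, re-proved here to keep the imports arithmetic). [folklore] -/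
private theorem exists_perm_of_map_eq {K : ℕ} {X : Type*} [DecidableEq X] {x y : Fin K → X}
    (h : univ.val.map x = univ.val.map y) : ∃ σ : Equiv.Perm (Fin K), y = x ∘ σ := by
  have hc : ∀ a : X, Fintype.card {i // y i = a} = Fintype.card {i // x i = a} := by
    intro a
    rw [Fintype.card_subtype, Fintype.card_subtype]
    have h1 : ∀ (z : Fin K → X), (univ.filter fun i ↦ z i = a).card = Multiset.count a (univ.val.map z) := by
      intro z
      rw [Multiset.count_map, ← Finset.filter_val, Finset.card_val]
      congr 1
      exact Finset.filter_congr fun i _ ↦ eq_comm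
    rw [h1, h1, h]
  have e : ∀ a : X, {i // y i = a} ≃ {i // x i = a} := fun a ↦ Fintype.equivOfCardEq (hc a)
  exact ⟨Equiv.ofFiberEquiv e, funext fun i ↦ (Equiv.ofFiberEquiv_map e i).symm⟩

/-- Tuples with a prescribed duplicate-free multiset of values: there are `n!` functions `α : Fin n → X` with
`univ.val.map α = t` when `t` is duplicate-free of cardinality `n` (they form one orbit `α₀ ∘ σ`, `σ ∈ 𝔖ₙ`, and
`α₀` is injective). [folklore] -/
private theorem card_filter_map_eq {n : ℕ} {X : Type*} [DecidableEq X] [Fintype X] (t : Multiset X)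
    (ht : t.Nodup) (hc : Multiset.card t = n) :
    (univ.filter fun α : Fin n → X ↦ univ.val.map α = t).card = n.factorial := by
  classical
  obtain ⟨r, α₀, h₀⟩ := exists_eq_univ_val_map t
  have hr : r = n := by
    have := congrArg Multiset.card h₀
    simp only [Multiset.card_map, Finset.card_val, Finset.card_univ, Fintype.card_fin] at this
    omega
  subst hr
  have hinj : Function.Injective α₀ := by
    have hnd : (univ.val.map α₀).Nodup := h₀ ▸ ht
    intro i j hij
    exact (Multiset.nodup_map_iff_inj_on univ.nodup).mp hnd i (Finset.mem_univ_val _) j (Finset.mem_univ_val _) hij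
  have hperm : ∀ σ : Equiv.Perm (Fin r), univ.val.map (α₀ ∘ σ) = univ.val.map α₀ := by
    intro σ
    have h : (univ : Finset (Fin r)).val.map (⇑σ) = (univ : Finset (Fin r)).val := by
      have h := congrArg Finset.val (Finset.map_univ_equiv σ)
      rwa [Finset.map_val, Equiv.coe_toEmbedding] at h
    rw [← Multiset.map_map, h]
  have hset : (univ.filter fun α : Fin r → X ↦ univ.val.map α = t) =
      univ.image fun σ : Equiv.Perm (Fin r) ↦ α₀ ∘ σ := by
    ext β
    simp only [Finset.mem_filter, Finset.mem_univ, true_and, Finset.mem_image]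
    constructor
    · intro hβ
      obtain ⟨σ, hσ⟩ := exists_perm_of_map_eq (h₀.trans hβ.symm)
      exact ⟨σ, hσ.symm⟩
    · rintro ⟨σ, rfl⟩
      rw [hperm, h₀]
  have hinj' : Function.Injective fun σ : Equiv.Perm (Fin r) ↦ (α₀ ∘ σ : Fin r → X) :=
    fun σ τ h ↦ Equiv.ext fun i ↦ hinj (congrFun h i)
  rw [hset, Finset.card_image_of_injective _ hinj', Finset.card_univ, Fintype.card_perm, Fintype.card_fin]

/-- If every member of `T` is duplicate-free of cardinality `n`, then `n! · |T|` functions `Fin n → X` have their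
multiset of values in `T`. [folklore] -/
private theorem card_filter_map_mem {n : ℕ} {X : Type*} [DecidableEq X] [Fintype X] (T : Finset (Multiset X))
    (hT : ∀ t ∈ T, t.Nodup ∧ Multiset.card t = n) :
    (univ.filter fun α : Fin n → X ↦ univ.val.map α ∈ T).card = n.factorial * T.card := by
  classical
  have H : ((univ.filter fun α : Fin n → X ↦ univ.val.map α ∈ T : Finset (Fin n → X)) : Set (Fin n → X)).MapsTo
      (fun α : Fin n → X ↦ univ.val.map α) (T : Set (Multiset X)) := fun α hα ↦
    Finset.mem_coe.mpr (Finset.mem_filter.mp (Finset.mem_coe.mp hα)).2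
  rw [Finset.card_eq_sum_card_fiberwise H]
  have h : ∀ t ∈ T, ((univ.filter fun α : Fin n → X ↦ univ.val.map α ∈ T).filter
      fun α ↦ univ.val.map α = t).card = n.factorial := by
    intro t htT
    rw [Finset.filter_filter]
    have e : (univ.filter fun α : Fin n → X ↦ univ.val.map α ∈ T ∧ univ.val.map α = t) =
        univ.filter fun α : Fin n → X ↦ univ.val.map α = t := by
      refine Finset.filter_congr fun α _ ↦ ⟨fun h ↦ h.2, fun h ↦ ⟨?_, h⟩⟩
      rw [h]
      exact htT
    rw [e]
    exact card_filter_map_eq t (hT t htT).1 (hT t htT).2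
  rw [Finset.sum_congr rfl h, Finset.sum_const, smul_eq_mul, mul_comm]

end Counting

section PrimePowCount

variable {p k : ℕ}

/-- The multiples of `p` in `ℤ/pᵏ` (residues with `p ∣ ⟨w⟩`) number `pᵏ/p`. [folklore] -/
private theorem card_filter_dvd_val (hp : p.Prime) (hk : 0 < k) [NeZero (p ^ k)] :
    (univ.filter fun w : ZMod (p ^ k) ↦ p ∣ w.val).card = p ^ k / p := by
  classical
  have hpd : p * (p ^ k / p) = p ^ k := Nat.mul_div_cancel' (dvd_pow_self p hk.ne')
  have hset : (univ.filter fun w : ZMod (p ^ k) ↦ p ∣ w.val) =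
      (Finset.range (p ^ k / p)).image fun j : ℕ ↦ ((p * j : ℕ) : ZMod (p ^ k)) := by
    ext w
    simp only [Finset.mem_filter, Finset.mem_univ, true_and, Finset.mem_image, Finset.mem_range]
    constructor
    · intro hw
      refine ⟨w.val / p, Nat.div_lt_div_of_lt_of_dvd (dvd_pow_self p hk.ne') (ZMod.val_lt w), ?_⟩
      rw [Nat.mul_div_cancel' hw, ZMod.natCast_zmod_val]
    · rintro ⟨j, hj, rfl⟩
      rw [ZMod.val_natCast, Nat.mod_eq_of_lt]
      · exact dvd_mul_right p j
      · calc p * j < p * (p ^ k / p) := Nat.mul_lt_mul_of_pos_left hj hp.pos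
          _ = p ^ k := hpd
  rw [hset, Finset.card_image_of_injOn, Finset.card_range]
  intro j hj j' hj' h
  have hj2 : p * j < p ^ k := by
    calc p * j < p * (p ^ k / p) := Nat.mul_lt_mul_of_pos_left (Finset.mem_range.mp hj) hp.pos
      _ = p ^ k := hpd
  have hj2' : p * j' < p ^ k := by
    calc p * j' < p * (p ^ k / p) := Nat.mul_lt_mul_of_pos_left (Finset.mem_range.mp hj') hp.pos
      _ = p ^ k := hpd
  have h' := congrArg ZMod.val h
  simp only [ZMod.val_natCast, Nat.mod_eq_of_lt hj2, Nat.mod_eq_of_lt hj2'] at h'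
  exact Nat.eq_of_mul_eq_mul_left hp.pos h'

/-- A residue killed by an integer prime to `pᵏ` is zero. [folklore] -/
private theorem eq_zero_of_coprime_mul {n : ℕ} (hn : Nat.Coprime n (p ^ k)) [NeZero (p ^ k)] {w : ZMod (p ^ k)}
    (h : (n : ZMod (p ^ k)) * w = 0) : w = 0 := by
  have hu : IsUnit ((n : ℕ) : ZMod (p ^ k)) := by
    have := (ZMod.unitOfCoprime n hn).isUnit
    rwa [ZMod.coe_unitOfCoprime] at this
  exact (hu.mul_right_eq_zero).mp h

/-- The fibre `{x | p x = p c}` of multiplication by `p` is Aoki's progression `{c + i d}_{i<p}`. [folklore] -/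
private theorem filter_p_mul_eq_val (hp : p.Prime) (hk : 0 < k) [NeZero (p ^ k)] (c : ZMod (p ^ k)) :
    (univ.filter fun x : ZMod (p ^ k) ↦ (p : ZMod (p ^ k)) * x = (p : ZMod (p ^ k)) * c).val =
      (Multiset.range p).map (fun i : ℕ ↦ c + (i : ZMod (p ^ k)) * ((p ^ k / p : ℕ) : ZMod (p ^ k))) := by
  classical
  rw [range_map_eq_filter hp hk c]
  congr 1
  exact Finset.filter_congr fun x _ ↦ p_mul_eq_iff hp hk x c


/-- A residue fixed by multiplication by a nilpotent element is zero (`w = q w`, `qⁿ = 0` ⇒ `w = 0`). [folklore] -/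
private theorem eq_zero_of_eq_mul_of_pow_eq_zero {R : Type*} [CommRing R] {q w : R} (h : w = q * w) {n : ℕ}
    (hq : q ^ n = 0) : w = 0 := by
  have key : ∀ i : ℕ, w = q ^ i * w := by
    intro i
    induction i with
    | zero => simp
    | succ i ih => rw [pow_succ, mul_assoc, ← h, ← ih]
  rw [key n, hq, zero_mul]

/-- `p` is nilpotent in `ℤ/pᵏ`: `pᵏ = 0`. [folklore] -/
private theorem natCast_p_pow_eq_zero : ((p : ZMod (p ^ k))) ^ k = 0 := by
  rw [← Nat.cast_pow, ZMod.natCast_self]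

variable [NeZero p]

/-- `σ_{p, w/p}` as a function of `w ∈ pℤ/pᵏ` (`p` odd): the fibre of `w` under multiplication by `p`, plus `−w`. [folklore] -/
private def stdOddOf (p k : ℕ) [NeZero p] (w : ZMod (p ^ k)) : Multiset (ZMod (p ^ k)) :=
  (univ.filter fun x : ZMod (p ^ k) ↦ (p : ZMod (p ^ k)) * x = w).val + {-w}

/-- The non-zero multiples of `p` in `ℤ/pᵏ`. [folklore] -/
private def multiplesOf (p k : ℕ) [NeZero p] : Finset (ZMod (p ^ k)) :=
  (univ.filter fun w : ZMod (p ^ k) ↦ p ∣ w.val).erase 0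

/-- Membership in `multiplesOf`. [folklore] -/
private theorem mem_multiplesOf {w : ZMod (p ^ k)} : w ∈ multiplesOf p k ↔ w ≠ 0 ∧ p ∣ w.val := by
  simp [multiplesOf]

/-- Every `w ∈ pℤ/pᵏ` is `pc`. [folklore] -/
private theorem exists_eq_p_mul {w : ZMod (p ^ k)} (hw : p ∣ w.val) : ∃ c : ZMod (p ^ k), (p : ZMod (p ^ k)) * c = w := by
  obtain ⟨j, hj⟩ := hw
  exact ⟨(j : ZMod (p ^ k)), by rw [← Nat.cast_mul, ← hj, ZMod.natCast_zmod_val]⟩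

/-- `stdOddOf (pc) = {c + i d}_{i<p} + {−pc}` (the tree's spelling of `σ_{p,c}`, `p` odd). [folklore] -/
private theorem stdOddOf_p_mul (hp : p.Prime) (hk : 0 < k) (c : ZMod (p ^ k)) :
    stdOddOf p k ((p : ZMod (p ^ k)) * c) =
      (Multiset.range p).map (fun i : ℕ ↦ c + (i : ZMod (p ^ k)) * ((p ^ k / p : ℕ) : ZMod (p ^ k)))
        + {-((p : ZMod (p ^ k)) * c)} := by
  rw [stdOddOf, filter_p_mul_eq_val hp hk c]

/-- `|pℤ/pᵏ ∖ {0}| = pᵏ/p − 1`. [folklore] -/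
private theorem card_multiplesOf (hp : p.Prime) (hk : 0 < k) : (multiplesOf p k).card = p ^ k / p - 1 := by
  rw [multiplesOf, Finset.card_erase_of_mem, card_filter_dvd_val hp hk]
  simp

omit [NeZero p] in
/-- `2` is a unit modulo an odd prime power: `2x = 0 ⇒ x = 0`. [folklore] -/
private theorem eq_zero_of_two_mul_eq_zero (hp : p.Prime) (hp2 : p ≠ 2) {x : ZMod (p ^ k)} (h : 2 * x = 0) : x = 0 := by
  have hcop : Nat.Coprime 2 (p ^ k) :=
    Nat.Coprime.pow_right k ((Nat.coprime_primes Nat.prime_two hp).mpr (Ne.symm hp2))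
  have hu : IsUnit (2 : ZMod (p ^ k)) := by
    have := (ZMod.unitOfCoprime 2 hcop).isUnit
    rwa [ZMod.coe_unitOfCoprime, Nat.cast_ofNat] at this
  exact (hu.mul_right_eq_zero).mp h

omit [NeZero p] in
/-- In `σ_{p,c}` (`p` odd, `pc ≠ 0`) the residue `c` occurs and `−c` does not: the standard multisets are not negation-symmetric.
[folklore] -/
private theorem count_std_self_and_neg (hp : p.Prime) (hp2 : p ≠ 2) (hk : 0 < k) {c : ZMod (p ^ k)}
    (hc : (p : ZMod (p ^ k)) * c ≠ 0) :
    count c ((Multiset.range p).map (fun i : ℕ ↦ c + (i : ZMod (p ^ k)) * ((p ^ k / p : ℕ) : ZMod (p ^ k)))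
        + {-((p : ZMod (p ^ k)) * c)}) = 1 ∧
      count (-c) ((Multiset.range p).map (fun i : ℕ ↦ c + (i : ZMod (p ^ k)) * ((p ^ k / p : ℕ) : ZMod (p ^ k)))
        + {-((p : ZMod (p ^ k)) * c)}) = 0 := by
  classical
  have hc0 : c ≠ 0 := fun e ↦ hc (by rw [e, mul_zero])
  constructor
  · rw [Multiset.count_add, count_range_map hp hk, if_pos rfl, Multiset.count_singleton, if_neg]
    intro e
    -- `c = −pc` gives `c = (−p) c`, and `−p` is nilpotent
    have e' : c = (-(p : ZMod (p ^ k))) * c := by linear_combination e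
    exact hc0 (eq_zero_of_eq_mul_of_pow_eq_zero e' (n := k) (by rw [neg_pow, natCast_p_pow_eq_zero, mul_zero]))
  · rw [Multiset.count_add, count_range_map hp hk, Multiset.count_singleton, if_neg, if_neg]
    · intro e
      rw [neg_inj] at e
      have e' : c = (p : ZMod (p ^ k)) * c := e
      exact hc0 (eq_zero_of_eq_mul_of_pow_eq_zero e' natCast_p_pow_eq_zero)
    · intro e
      rw [mul_neg] at e
      apply hc
      apply eq_zero_of_two_mul_eq_zero hp hp2
      linear_combination -e

/-- Members of the family `stdOddOf` on `pℤ/pᵏ ∖ {0}`: duplicate-free of cardinality `p + 1`. [folklore] -/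
private theorem nodup_card_stdOddOf (hp : p.Prime) (hk : 0 < k) {w : ZMod (p ^ k)} (hw : w ∈ multiplesOf p k) :
    (stdOddOf p k w).Nodup ∧ Multiset.card (stdOddOf p k w) = p + 1 := by
  classical
  rw [mem_multiplesOf] at hw
  obtain ⟨hw0, hwp⟩ := hw
  obtain ⟨c, hpc⟩ := exists_eq_p_mul hwp
  have hnot : -w ∉ (univ.filter fun x : ZMod (p ^ k) ↦ (p : ZMod (p ^ k)) * x = w).val := by
    intro h
    rw [Finset.mem_val, Finset.mem_filter] at h
    -- `p(−w) = w` gives `w = (−p) w`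
    have e' : w = (-(p : ZMod (p ^ k))) * w := by linear_combination -h.2
    exact hw0 (eq_zero_of_eq_mul_of_pow_eq_zero e' (n := k) (by rw [neg_pow, natCast_p_pow_eq_zero, mul_zero]))
  constructor
  · rw [stdOddOf, Multiset.Nodup.add_iff (Finset.nodup _) (Multiset.nodup_singleton _), Multiset.disjoint_singleton]
    exact hnot
  · rw [← hpc, stdOddOf_p_mul hp hk, Multiset.card_add, Multiset.card_map, Multiset.card_range, Multiset.card_singleton]

/-- `w ↦ stdOddOf w` is injective on `pℤ/pᵏ ∖ {0}` (`stdOddOf w = stdOddOf w'` with `w ≠ w'` forces `w' = −pw`, `w = −pw'`,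
so `w = p²w = p⁴w = ⋯ = 0`). [folklore] -/
private theorem stdOddOf_injOn (p k : ℕ) [NeZero p] : Set.InjOn (stdOddOf p k) (multiplesOf p k) := by
  classical
  intro w hw w' hw' h
  rw [Finset.mem_coe, mem_multiplesOf] at hw hw'
  by_contra hne
  have mem1 : -w ∈ stdOddOf p k w' := by
    rw [← h, stdOddOf]
    exact Multiset.mem_add.mpr (Or.inr (Multiset.mem_singleton_self _))
  have mem2 : -w' ∈ stdOddOf p k w := by
    rw [h, stdOddOf]
    exact Multiset.mem_add.mpr (Or.inr (Multiset.mem_singleton_self _))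
  rw [stdOddOf, Multiset.mem_add, Finset.mem_val, Finset.mem_filter, Multiset.mem_singleton, neg_inj] at mem1 mem2
  rcases mem1 with ⟨-, h1⟩ | h1
  · rcases mem2 with ⟨-, h2⟩ | h2
    · have e' : w = ((p : ZMod (p ^ k)) ^ 2) * w := by linear_combination (p : ZMod (p ^ k)) * h1 - h2
      exact hw.1 (eq_zero_of_eq_mul_of_pow_eq_zero e' (n := k) (by rw [← pow_mul, pow_mul', natCast_p_pow_eq_zero, zero_pow two_ne_zero]))
    · exact hne h2.symm
  · exact hne h1

/-- **The non-symmetric Hodge `(p+1)`-tuples at odd prime-power level as a fibre of the multiset map**: `α : Fin (p+1) → ℤ/pᵏ` is a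
Hodge character with non-symmetric multiplicities iff its multiset of values is `stdOddOf w` for some `w ∈ pℤ/pᵏ ∖ {0}`.
[cite: Shioda1982PicardFermat, Thm 6 (b) p. 731] [cite: Shioda1981FermatType, Appendix (A.1), pp. 78–79] -/
private theorem filter_not_symmetric_eq (hp : p.Prime) (hp2 : p ≠ 2) (hk : 0 < k) :
    (univ.filter fun α : Fin (p + 1) → ZMod (p ^ k) ↦ IsHodge α ∧
        ¬ ∀ x, count x (univ.val.map α) = count (-x) (univ.val.map α)) =
      univ.filter fun α : Fin (p + 1) → ZMod (p ^ k) ↦ univ.val.map α ∈ (multiplesOf p k).image (stdOddOf p k) := by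
  classical
  ext α
  simp only [Finset.mem_filter, Finset.mem_univ, true_and, Finset.mem_image]
  constructor
  · rintro ⟨hα, hns⟩
    push Not at hns
    have hcard : Multiset.card (univ.val.map α) = p + 1 := by simp
    obtain ⟨c, hc, hsc⟩ := eq_pStandard_of_not_symmetric hp hp2 hk hα.isHodgeMultiset hcard hns
    refine ⟨(p : ZMod (p ^ k)) * c, mem_multiplesOf.mpr ⟨hc, dvd_val_p_mul hp hk c⟩, ?_⟩
    rw [stdOddOf_p_mul hp hk, hsc]
  · rintro ⟨w, hw, hαw⟩
    obtain ⟨hw0, hwp⟩ := mem_multiplesOf.mp hw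
    obtain ⟨c, hpc⟩ := exists_eq_p_mul hwp
    rw [← hpc] at hw0
    rw [← hpc, stdOddOf_p_mul hp hk] at hαw
    refine ⟨(isHodge_iff_isHodgeMultiset α).2 ?_, fun hsym ↦ ?_⟩
    · have h := isHodgeMultiset_std hp hk hw0
      rw [if_neg hp2, add_zero] at h
      rw [← hαw]
      exact h
    · have h1 := (count_std_self_and_neg hp hp2 hk hw0).1
      have h2 := (count_std_self_and_neg hp hp2 hk hw0).2
      rw [hαw] at h1 h2
      have := hsym c
      omega

/-- **Counting the non-symmetric Hodge `(p+1)`-tuples at odd prime-power level**: at `m = pᵏ` (`p` odd, `k ≥ 1`) there are exactly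
`(p+1)! · (m/p − 1)` Hodge characters `α : Fin (p+1) → ℤ/m` with non-symmetric multiplicities (the orderings of the `m/p − 1` standard
multisets `σ_{p,c}`). Printed instances: `p = 3` — Shioda 1982, `|𝔍²_{3ⁿ}| = 8(m − 3)` (formula (5) with Thm 6 (b), Thm 8 (ii));
`m = 25` — Shioda 1981, Appendix p. 79, "`𝔅⁴₂₅` has `4·6!` indecomposable elements". The uniform statement is this formalisation's.
[cite: Shioda1982PicardFermat, (5) p. 726 and Thm 8 (ii) p. 732] [cite: Shioda1981FermatType, Appendix (A.1), pp. 78–79] -/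
theorem card_hodge_not_symmetric_prime_pow (hp : p.Prime) (hp2 : p ≠ 2) (hk : 0 < k) :
    (univ.filter fun α : Fin (p + 1) → ZMod (p ^ k) ↦ IsHodge α ∧
        ¬ ∀ x, count x (univ.val.map α) = count (-x) (univ.val.map α)).card = (p + 1).factorial * (p ^ k / p - 1) := by
  classical
  rw [filter_not_symmetric_eq hp hp2 hk, card_filter_map_mem _ fun t ht ↦ ?_, Finset.card_image_of_injOn (stdOddOf_injOn p k),
    card_multiplesOf hp hk]
  obtain ⟨w, hw, rfl⟩ := Finset.mem_image.mp ht
  exact nodup_card_stdOddOf hp hk hw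

end PrimePowCount

/-! ## Level `m = 3ⁿ`: Theorem 6 (b) -/

section ThreePow

variable {k : ℕ}

/-- `d = m/3` as a residue modulo `m = 3ᵏ`. -/
local notation "𝔡" => (((3 ^ k / 3 : ℕ) : ZMod (3 ^ k)))

/-- **Shioda's standard element `γ_j = (j, m″ + j, 2m″ + j, m − 3j)`** of level `m = 3m″` (Lemma 1 (b)), here at
`m = 3ᵏ` (`m″ = d = 3ᵏ⁻¹`) and for an arbitrary residue `j = c` (for `3 ∣ c` these are the multiples `3·γ_{c/3}` of
the standard elements of level `m/3`). [cite: Shioda1982PicardFermat, §4 Lemma 1 (b) p. 728] -/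
def gammaStd (c : ZMod (3 ^ k)) : Fin 4 → ZMod (3 ^ k) := ![c, 𝔡 + c, 2 * 𝔡 + c, -(3 * c)]

/-- The multiset of values of `γ_c` is Aoki's `3`-standard multiset `σ_{3,c} = {c, c + d, c + 2d} + {−3c}`
(the tree's spelling, `FermatHodgeCharactersPrimePow`). [cite: Shioda1982PicardFermat, §4 Lemma 1 (b) p. 728] -/
theorem univ_val_map_gammaStd (c : ZMod (3 ^ k)) :
    univ.val.map (gammaStd c) =
      (Multiset.range 3).map (fun i : ℕ ↦ c + (i : ZMod (3 ^ k)) * 𝔡) + {-(((3 : ℕ) : ZMod (3 ^ k)) * c)} := by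
  have e1 : univ.val.map (gammaStd c) = {c, 𝔡 + c, 2 * 𝔡 + c, -(3 * c)} := by
    simp [gammaStd, Fin.univ_val_map]
    rfl
  have e2 : (Multiset.range 3).map (fun i : ℕ ↦ c + (i : ZMod (3 ^ k)) * 𝔡) = {2 * 𝔡 + c, 𝔡 + c, c} := by
    simp [Multiset.range_succ, add_comm, mul_comm]
  rw [e1, e2, Nat.cast_ofNat]
  simp only [Multiset.insert_eq_cons, Multiset.cons_add, Multiset.singleton_add]
  rw [Multiset.cons_swap (2 * 𝔡 + c) (𝔡 + c), Multiset.cons_swap (2 * 𝔡 + c) c, Multiset.cons_swap (𝔡 + c) c]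


/-- `3 d = 0` in `ℤ/3ᵏ`. [folklore] -/
private theorem three_mul_d (hk : 0 < k) : (3 : ZMod (3 ^ k)) * 𝔡 = 0 := by
  have := p_mul_natCast_div (p := 3) hk
  rwa [Nat.cast_ofNat] at this

/-- `2` is a unit modulo `3ᵏ`. [folklore] -/
private theorem isUnit_two : IsUnit (2 : ZMod (3 ^ k)) := by
  have hcop : Nat.Coprime 2 (3 ^ k) := Nat.Coprime.pow_right k (by norm_num)
  have := (ZMod.unitOfCoprime 2 hcop).isUnit
  rwa [ZMod.coe_unitOfCoprime, Nat.cast_ofNat] at this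

/-- **`γ_c ∈ 𝔅²ₘ`** (`m = 3ᵏ`, `3c ≠ 0`): the standard elements are Hodge characters (Lemma 1 (b): "indecomposable
elements of `𝔅²ₘ`"; here via the tree's `isHodgeMultiset_std`). [cite: Shioda1982PicardFermat, §4 Lemma 1 (b) p. 728] -/
theorem isHodge_gammaStd (hk : 0 < k) {c : ZMod (3 ^ k)} (hc : 3 * c ≠ 0) : IsHodge (gammaStd c) := by
  haveI : NeZero (3 ^ k) := ⟨pow_ne_zero _ three_ne_zero⟩
  rw [isHodge_iff_isHodgeMultiset, univ_val_map_gammaStd]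
  have hc' : ((3 : ℕ) : ZMod (3 ^ k)) * c ≠ 0 := by rwa [Nat.cast_ofNat]
  have h := isHodgeMultiset_std (p := 3) Nat.prime_three hk hc'
  rwa [if_neg (by norm_num : (3 : ℕ) ≠ 2), add_zero] at h

/-- **`γ_c` is indecomposable** (`m = 3ᵏ`, `3c ≠ 0`): no two of `c, d + c, 2d + c, −3c` sum to `0` (each such relation
would give `2 · 3c = 0`, and `2` is a unit). [cite: Shioda1982PicardFermat, §4 Lemma 1 (b) p. 728] -/
theorem gammaStd_add_ne_zero (hk : 0 < k) {c : ZMod (3 ^ k)} (hc : 3 * c ≠ 0) :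
    ∀ i j : Fin 4, i ≠ j → gammaStd c i + gammaStd c j ≠ 0 := by
  have hd := three_mul_d (k := k) hk
  intro i j hij h
  apply hc
  apply (isUnit_two (k := k)).mul_right_eq_zero.mp
  fin_cases i <;> fin_cases j <;> simp [gammaStd] at hij h ⊢ <;>
    first
    | linear_combination 3 * h - hd
    | linear_combination -3 * h + hd
    | linear_combination 3 * h - 2 * hd
    | linear_combination -3 * h + 2 * hd
    | linear_combination 3 * h - 3 * hd
    | linear_combination -3 * h + 3 * hd
    | linear_combination 3 * h
    | linear_combination -3 * h

/-- **Theorem 6 (b), multiset form**: at level `m = 3ᵏ` the multiset of values of an indecomposable `α ∈ 𝔅²ₘ` is a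
`3`-standard multiset `σ_{3,c} = {c, c + d, c + 2d, −3c}` with `3c ≠ 0` (`eq_pStandard_of_not_symmetric` at `p = 3`; an
indecomposable `α` is not negation-symmetric since `m` is odd). [cite: Shioda1982PicardFermat, Thm 6 (b) p. 731] -/
theorem map_eq_std_of_indecomposable (hk : 0 < k) {α : Fin 4 → ZMod (3 ^ k)} (hα : IsHodge α)
    (hind : ∀ i j : Fin 4, i ≠ j → α i + α j ≠ 0) :
    ∃ c : ZMod (3 ^ k), ((3 : ℕ) : ZMod (3 ^ k)) * c ≠ 0 ∧
      univ.val.map α = (Multiset.range 3).map (fun i : ℕ ↦ c + (i : ZMod (3 ^ k)) * 𝔡)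
        + {-(((3 : ℕ) : ZMod (3 ^ k)) * c)} := by
  classical
  haveI : NeZero (3 ^ k) := ⟨pow_ne_zero _ three_ne_zero⟩
  have hs := hα.isHodgeMultiset
  have hcard : Multiset.card (univ.val.map α) = 3 + 1 := by simp
  have hns : ∃ x, count x (univ.val.map α) ≠ count (-x) (univ.val.map α) := by
    by_contra h
    push Not at h
    have hx0 : α 0 ≠ 0 := hα.1.1 0
    have hxx : α 0 ≠ -α 0 := fun e ↦ by
      have := (eq_half_of_eq_neg (p := 3) Nat.prime_three hk e hx0).1
      norm_num at this
    have hmem : α 0 ∈ univ.val.map α := Multiset.mem_map.mpr ⟨0, Finset.mem_univ_val 0, rfl⟩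
    have hmem' : -α 0 ∈ univ.val.map α := by
      rw [← Multiset.count_pos, ← h, Multiset.count_pos]
      exact hmem
    obtain ⟨j, -, hj⟩ := Multiset.mem_map.mp hmem'
    have hj0 : j ≠ 0 := by
      rintro rfl
      exact hxx hj
    exact hind 0 j hj0.symm (by rw [hj, add_neg_cancel])
  exact eq_pStandard_of_not_symmetric (p := 3) Nat.prime_three (by norm_num) hk hs hcard hns

/-- **Shioda 1982, Theorem 6 (b) (all `3`-power levels, permutation form).** Let `m = 3ᵏ`, `k ≥ 1`. Every
indecomposable Hodge character `α ∈ 𝔅²ₘ` (`αᵢ + αⱼ ≠ 0` for `i ≠ j`) is a permutation of a standard element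
`γ_c = (c, d + c, 2d + c, −3c)`, `d = m/3`, with `3c ≠ 0` (Shioda, for primitive `α`: "any indecomposable element of
`𝔅²ₘ` with `GCD(α) = 1` … is a permutation of one of `γⱼ` (`1 ≤ j ≤ m/3`, `(j, 3) = 1`)"; the normalisation of `c` is
`exists_perm_gammaStd_lt`). PROOF: not Shioda's (Koblitz–Rohrlich at level `3ⁿ` + Prop. 5) but the odd-part /
level-lowering argument of the tree's `FermatHodgeCharactersPrimePow` (Koblitz–Ogus), see `eq_pStandard_of_not_symmetric`.
[cite: Shioda1982PicardFermat, Thm 6 (b) p. 731] -/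
theorem exists_perm_gammaStd (hk : 0 < k) {α : Fin 4 → ZMod (3 ^ k)} (hα : IsHodge α)
    (hind : ∀ i j : Fin 4, i ≠ j → α i + α j ≠ 0) :
    ∃ (c : ZMod (3 ^ k)) (σ : Equiv.Perm (Fin 4)), 3 * c ≠ 0 ∧ ∀ i, α (σ i) = gammaStd c i := by
  classical
  obtain ⟨c, hc, hsc⟩ := map_eq_std_of_indecomposable hk hα hind
  rw [← univ_val_map_gammaStd] at hsc
  obtain ⟨σ, hσ⟩ := exists_perm_of_map_eq hsc
  refine ⟨c, σ, by rwa [Nat.cast_ofNat] at hc, fun i ↦ ?_⟩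
  exact (congrFun hσ i).symm

/-- **Theorem 6 (b) in the printed normalisation.** At level `m = 3ᵏ`, an indecomposable `α ∈ 𝔅²ₘ` with `GCD(α) = 1` (no
`g > 1` divides all representatives `⟨αᵢ⟩`) is a permutation of `γⱼ = (j, m″ + j, 2m″ + j, m − 3j)` for some integer
`1 ≤ j < m″ = m/3` prime to `3`: "any indecomposable element of `𝔅²ₘ` with `GCD(α) = 1` (i.e. any element of `𝔍²ₘ(1)`) is a
permutation of one of `γⱼ` (`1 ≤ j ≤ m/3`, `(j, 3) = 1`) of Lemma 1." (Reduce `c` of `exists_perm_gammaStd` modulo `m″`: the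
multiset `σ_{3,c}` only depends on `3c`; if `3 ∣ j` every representative of `γⱼ` is divisible by `3`.)
[cite: Shioda1982PicardFermat, Thm 6 (b) p. 731] -/
theorem exists_perm_gammaStd_lt (hk : 0 < k) {α : Fin 4 → ZMod (3 ^ k)} (hα : IsHodge α)
    (hind : ∀ i j : Fin 4, i ≠ j → α i + α j ≠ 0) (hprim : ∀ g : ℕ, (∀ i, g ∣ (α i).val) → g = 1) :
    ∃ (j : ℕ) (σ : Equiv.Perm (Fin 4)), 1 ≤ j ∧ j < 3 ^ k / 3 ∧ ¬ 3 ∣ j ∧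
      ∀ i, α (σ i) = gammaStd (j : ZMod (3 ^ k)) i := by
  classical
  obtain ⟨c, hc, hsc⟩ := map_eq_std_of_indecomposable hk hα hind
  have hd3 : 3 * (3 ^ k / 3) = 3 ^ k := Nat.mul_div_cancel' (dvd_pow_self 3 hk.ne')
  have hpos : 0 < 3 ^ k := by positivity
  have hd0 : 0 < 3 ^ k / 3 := by omega
  set j : ℕ := c.val % (3 ^ k / 3) with hjdef
  have hjlt : j < 3 ^ k / 3 := Nat.mod_lt _ hd0
  have hjval : (j : ZMod (3 ^ k)).val = j := by
    rw [ZMod.val_natCast, Nat.mod_eq_of_lt (by omega)]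
  have h3j : ((3 : ℕ) : ZMod (3 ^ k)) * (j : ZMod (3 ^ k)) = ((3 : ℕ) : ZMod (3 ^ k)) * c := by
    rw [p_mul_eq_iff Nat.prime_three hk, hjval, hjdef, Nat.mod_mod]
  have hprog : (Multiset.range 3).map (fun i : ℕ ↦ (j : ZMod (3 ^ k)) + (i : ZMod (3 ^ k)) * 𝔡) =
      (Multiset.range 3).map (fun i : ℕ ↦ c + (i : ZMod (3 ^ k)) * 𝔡) := by
    rw [← filter_p_mul_eq_val Nat.prime_three hk c, ← filter_p_mul_eq_val Nat.prime_three hk (j : ZMod (3 ^ k)), h3j]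
  have hsc' : univ.val.map α = univ.val.map (gammaStd (j : ZMod (3 ^ k))) := by
    rw [univ_val_map_gammaStd, hprog, h3j, hsc]
  obtain ⟨σ, hσ⟩ := exists_perm_of_map_eq hsc'
  have hj1 : 1 ≤ j := by
    by_contra h
    have h0 : j = 0 := by omega
    rw [h0, Nat.cast_zero, mul_zero] at h3j
    exact hc h3j.symm
  refine ⟨j, σ, hj1, hjlt, fun h3 ↦ ?_, fun i ↦ (congrFun hσ i).symm⟩
  -- if `3 ∣ j`, every representative of `γ_j` (hence of `α`) is divisible by `3`
  have hk2' : 2 ≤ k := by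
    by_contra h
    have h1 : k = 1 := by omega
    subst h1
    norm_num at hjlt
    omega
  have hk2 : 3 ∣ 3 ^ k / 3 := by
    have h9 : 9 ∣ 3 ^ k := by
      have : 3 ^ 2 ∣ 3 ^ k := pow_dvd_pow 3 hk2'
      simpa using this
    omega
  have hval1 : ((𝔡 : ZMod (3 ^ k)) + (j : ZMod (3 ^ k))).val = 3 ^ k / 3 + j := by
    rw [← Nat.cast_add, ZMod.val_natCast, Nat.mod_eq_of_lt (by omega)]
  have hval2 : (2 * (𝔡 : ZMod (3 ^ k)) + (j : ZMod (3 ^ k))).val = 2 * (3 ^ k / 3) + j := by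
    rw [show (2 * (𝔡 : ZMod (3 ^ k)) + (j : ZMod (3 ^ k))) = ((2 * (3 ^ k / 3) + j : ℕ) : ZMod (3 ^ k)) by push_cast; ring,
      ZMod.val_natCast, Nat.mod_eq_of_lt (by omega)]
  have hval3 : (-(3 * (j : ZMod (3 ^ k)))).val = 3 ^ k - 3 * j := by
    have e : (3 * (j : ZMod (3 ^ k))) = ((3 * j : ℕ) : ZMod (3 ^ k)) := by push_cast; ring
    have hne : (3 * (j : ZMod (3 ^ k))) ≠ 0 := by
      rw [e]
      intro h0
      rw [ZMod.natCast_eq_zero_iff] at h0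
      have := Nat.le_of_dvd (by omega) h0
      omega
    rw [ZMod.neg_val, if_neg hne, e, ZMod.val_natCast, Nat.mod_eq_of_lt (by omega)]
  have hall : ∀ l : Fin 4, 3 ∣ (gammaStd (j : ZMod (3 ^ k)) l).val := by
    intro l
    fin_cases l
    · simp only [gammaStd, Fin.zero_eta, Fin.isValue, Matrix.cons_val_zero, hjval]
      exact h3
    · simp only [gammaStd, Fin.mk_one, Fin.isValue, Matrix.cons_val_one, Matrix.cons_val_zero, hval1]
      exact Nat.dvd_add hk2 h3
    · simp only [gammaStd, Fin.reduceFinMk, Matrix.cons_val, hval2]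
      exact Nat.dvd_add (Dvd.dvd.mul_left hk2 2) h3
    · simp only [gammaStd, Fin.reduceFinMk, Matrix.cons_val, hval3]
      exact Nat.dvd_sub (dvd_pow_self 3 hk.ne') (Dvd.intro j rfl)
  have h31 := hprim 3 fun i ↦ by
    have e : α i = gammaStd (j : ZMod (3 ^ k)) (σ.symm i) := by
      have := congrFun hσ (σ.symm i)
      simp only [Function.comp_apply, Equiv.apply_symm_apply] at this
      exact this.symm
    rw [e]
    exact hall _
  omega

/-- **Theorem 6 (b), characterisation**: at level `m = 3ᵏ` the indecomposable elements of `𝔅²ₘ` are EXACTLY the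
permutations of the `γ_c` with `3c ≠ 0`. [cite: Shioda1982PicardFermat, Thm 6 (b) p. 731 and Lemma 1 (b) p. 728] -/
theorem indecomposable_iff_three_pow (hk : 0 < k) (α : Fin 4 → ZMod (3 ^ k)) :
    (IsHodge α ∧ ∀ i j : Fin 4, i ≠ j → α i + α j ≠ 0) ↔
      ∃ (c : ZMod (3 ^ k)) (σ : Equiv.Perm (Fin 4)), 3 * c ≠ 0 ∧ ∀ i, α (σ i) = gammaStd c i := by
  constructor
  · rintro ⟨hα, hind⟩
    exact exists_perm_gammaStd hk hα hind
  · rintro ⟨c, σ, hc, h⟩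
    have e : α = gammaStd c ∘ σ.symm := by
      funext j
      rw [Function.comp_apply, ← h (σ.symm j), Equiv.apply_symm_apply]
    refine ⟨e ▸ (isHodge_gammaStd hk hc).compEquiv σ.symm, fun i j hij ↦ ?_⟩
    rw [e]
    exact gammaStd_add_ne_zero hk hc _ _ (σ.symm.injective.ne hij)


/-! ### Counting: Theorem 8 (ii) -/

/-- At odd level an indecomposable `α ∈ 𝔅²ₘ`-candidate (all `αᵢ ≠ 0`, no `αᵢ + αⱼ = 0`) has non-symmetric multiplicities: `α₀`
occurs but `−α₀` does not. [folklore] -/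
private theorem not_symmetric_of_indecomposable {m : ℕ} [NeZero m] (hm : Odd m) {α : Fin 4 → ZMod m}
    (h0 : ∀ i, α i ≠ 0) (hind : ∀ i j : Fin 4, i ≠ j → α i + α j ≠ 0) :
    ¬ ∀ x, count x (univ.val.map α) = count (-x) (univ.val.map α) := by
  classical
  intro h
  have hxx : α 0 ≠ -α 0 := fun e ↦ by
    rcases (ZMod.neg_eq_self_iff (α 0)).mp e.symm with h' | h'
    · exact h0 0 h'
    · obtain ⟨r, hr⟩ := hm
      omega
  have hmem : α 0 ∈ univ.val.map α := Multiset.mem_map.mpr ⟨0, Finset.mem_univ_val 0, rfl⟩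
  have hmem' : -α 0 ∈ univ.val.map α := by
    rw [← Multiset.count_pos, ← h, Multiset.count_pos]
    exact hmem
  obtain ⟨j, -, hj⟩ := Multiset.mem_map.mp hmem'
  have hj0 : j ≠ 0 := by
    rintro rfl
    exact hxx hj
  exact hind 0 j hj0.symm (by rw [hj, add_neg_cancel])

/-- **`𝔍²ₘ` at `m = 3ᵏ`** = the Hodge quadruples with non-symmetric multiplicities. [cite: Shioda1982PicardFermat, Thm 6 (b) p. 731] -/
private theorem indecomposableQuadruples_three_pow (hk : 0 < k) :
    indecomposableQuadruples (3 ^ k) =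
      univ.filter fun α : Fin (3 + 1) → ZMod (3 ^ k) ↦ IsHodge α ∧
        ¬ ∀ x, count x (univ.val.map α) = count (-x) (univ.val.map α) := by
  classical
  ext α
  rw [mem_indecomposableQuadruples, Finset.mem_filter]
  simp only [Finset.mem_univ, true_and]
  constructor
  · rintro ⟨hα, hind⟩
    exact ⟨hα, not_symmetric_of_indecomposable ((by decide : Odd 3).pow) hα.1.1 hind⟩
  · rintro ⟨hα, hns⟩
    push Not at hns
    have hcard : Multiset.card (univ.val.map α) = 3 + 1 := by simp
    obtain ⟨c, hc, hsc⟩ := eq_pStandard_of_not_symmetric Nat.prime_three (by norm_num) hk hα.isHodgeMultiset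
      hcard hns
    rw [← univ_val_map_gammaStd] at hsc
    obtain ⟨σ, hσ⟩ := exists_perm_of_map_eq hsc
    have h3c : 3 * c ≠ 0 := by rwa [Nat.cast_ofNat] at hc
    exact (indecomposable_iff_three_pow hk α).mpr ⟨c, σ, h3c, fun i ↦ (congrFun hσ i).symm⟩

/-- **The number of indecomposable elements at level `3ᵏ`: `|𝔍²ₘ| = 24 (m/3 − 1) = 8(m − 3)`** (`m/3 − 1` standard
multisets `σ_{3,c}`, each with `4! = 24` orderings; in Shioda's notation `Σ_{d ∣ m, d < m} 24 g(m/d)` with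
`g(3ʲ) = φ(3ʲ⁻¹)` (`j ≥ 2`), `g(3) = 0`). [cite: Shioda1982PicardFermat, (5) p. 726 and Thm 8 (ii) p. 732] -/
theorem card_indecomposableQuadruples_three_pow (hk : 0 < k) :
    (indecomposableQuadruples (3 ^ k)).card = 24 * (3 ^ k / 3 - 1) := by
  rw [indecomposableQuadruples_three_pow hk, card_hodge_not_symmetric_prime_pow Nat.prime_three (by norm_num) hk]
  rfl

/-- **Shioda 1982, Theorem 8 (ii).** "If `m = 3ⁿ`, then `ρ(X²ₘ) = 3(m−1)(m−2) + 1 + 8(m−3)`": combinatorial content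
`|𝔅²ₘ| = 3(m−1)(m−2) + 8(m−3)` for every `m = 3ᵏ`, `k ≥ 1` (`ρ = |𝔅²ₘ| + 1` by (1), Lefschetz, not formalised);
`|𝔇²ₘ| = 3(m−1)(m−2)` by (3) (`m` odd) and `|𝔍²ₘ| = 8(m−3)` by Theorem 6 (b).
[cite: Shioda1982PicardFermat, Thm 8 (ii) p. 732] -/
theorem card_hodgeQuadruples_three_pow (hk : 0 < k) :
    (hodgeQuadruples (3 ^ k)).card = 3 * (3 ^ k - 1) * (3 ^ k - 2) + 8 * (3 ^ k - 3) := by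
  have hodd : ¬ Even (3 ^ k) := Nat.not_even_iff_odd.mpr ((by decide : Odd 3).pow)
  have h3 : 3 * (3 ^ k / 3) = 3 ^ k := Nat.mul_div_cancel' (dvd_pow_self 3 hk.ne')
  rw [card_hodgeQuadruples_eq_add, card_decomposableQuadruples, if_neg hodd, card_indecomposableQuadruples_three_pow hk]
  omega

/-- Theorem 8 (ii) with the Lefschetz summand: `|𝔅²ₘ| + 1 = 3(m−1)(m−2) + 1 + 8(m−3)` (`= ρ(X²ₘ)` by (1)).
[cite: Shioda1982PicardFermat, Thm 8 (ii) p. 732] -/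
theorem card_hodgeQuadruples_three_pow_add_one (hk : 0 < k) :
    (hodgeQuadruples (3 ^ k)).card + 1 = 3 * (3 ^ k - 1) * (3 ^ k - 2) + 1 + 8 * (3 ^ k - 3) := by
  rw [card_hodgeQuadruples_three_pow hk]
  ring

/-- Kernel cross-check of Theorem 8 (ii) at `m = 9`: direct evaluation of `𝔅²₉` in the kernel gives the value of the closed
formula, `|𝔅²₉| = 168 + 48 = 216` (`ρ(X²₉) = 217`); the theorem gives e.g. `|𝔅²₂₇| = 1950 + 192 = 2142`,
`|𝔅²₈₁| = 18960 + 624 = 19584` without evaluation. [cite: Shioda1982PicardFermat, Thm 8 (ii) p. 732] -/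
example : (hodgeQuadruples (3 ^ 2)).card = 3 * (3 ^ 2 - 1) * (3 ^ 2 - 2) + 8 * (3 ^ 2 - 3) := by
  decide +kernel

/-- `|𝔅²₂₇| = 2142` and `|𝔅²₈₁| = 19584` by Theorem 8 (ii). [cite: Shioda1982PicardFermat, Thm 8 (ii) p. 732] -/
example : (hodgeQuadruples (3 ^ 3)).card = 2142 ∧ (hodgeQuadruples (3 ^ 4)).card = 19584 := by
  rw [card_hodgeQuadruples_three_pow (by norm_num), card_hodgeQuadruples_three_pow (by norm_num)]
  decide

/-- **Aoki–Shioda 1983, Theorem `(𝔅²ₘ)` (ii) at the levels `m = 3ᵏ`, in the letter of the tree's named fact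
`Literature.AlgebraicGeometry.HodgeTheory.AokiShioda1983_thmB2m_standard`** (file `HodgeTheory/FermatSurfaceHodgeCharacterStructure`,
stated there for all `m > 180` with `(m, 6) > 1` as an unproved fact): a primitive indecomposable `α ∈ 𝔅²_{3ᵏ}` is a permutation
of c) `(j, d + j, 2d + j, −3j)`, `m = 3d`, `1 ≤ j < d`, `(j, d) = 1`, `6j ≠ m` — the body of that fact at `m = 3ᵏ` (alternatives
a), b) need `2 ∣ m`). PROOF: `exists_perm_gammaStd_lt` (Theorem 6 (b) in the printed normalisation).
[cite: AokiShioda1983, §2 Theorem (𝔅²ₘ) (ii) c), p. 3] [cite: Shioda1982PicardFermat, Thm 6 (b) p. 731] -/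
theorem thmB2m_standard_three_pow (hk : 0 < k) (α : Fin 4 → ZMod (3 ^ k)) (hα : IsHodge α)
    (hind : ∀ i j : Fin 4, i ≠ j → α i + α j ≠ 0) (hprim : ∀ g : ℕ, (∀ i, g ∣ (α i).val) → g = 1) :
    ∃ σ : Equiv.Perm (Fin 4),
      (∃ d i : ℕ, 3 ^ k = 2 * d ∧ 1 ≤ i ∧ i < d ∧ Nat.Coprime i d ∧ 4 * i ≠ 3 ^ k ∧
          ∀ l, α (σ l) = ![(i : ZMod (3 ^ k)), (d : ZMod (3 ^ k)) + i, -(2 * (i : ZMod (3 ^ k))), (d : ZMod (3 ^ k))] l) ∨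
      (∃ d i : ℕ, 3 ^ k = 2 * d ∧ 1 ≤ i ∧ i < d ∧ Nat.Coprime i d ∧ 3 * i ≠ 3 ^ k ∧ 4 * i ≠ 3 ^ k ∧ 6 * i ≠ 3 ^ k ∧
          ∀ l, α (σ l) =
            ![(i : ZMod (3 ^ k)), (d : ZMod (3 ^ k)) + i, (d : ZMod (3 ^ k)) + 2 * i, -(4 * (i : ZMod (3 ^ k)))] l) ∨
      (∃ d j : ℕ, 3 ^ k = 3 * d ∧ 1 ≤ j ∧ j < d ∧ Nat.Coprime j d ∧ 6 * j ≠ 3 ^ k ∧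
          ∀ l, α (σ l) =
            ![(j : ZMod (3 ^ k)), (d : ZMod (3 ^ k)) + j, 2 * (d : ZMod (3 ^ k)) + j, -(3 * (j : ZMod (3 ^ k)))] l) := by
  classical
  obtain ⟨j, σ, hj1, hjd, hj3, h⟩ := exists_perm_gammaStd_lt hk hα hind hprim
  have hd3 : 3 * (3 ^ k / 3) = 3 ^ k := Nat.mul_div_cancel' (dvd_pow_self 3 hk.ne')
  have hcop3k : Nat.Coprime j (3 ^ k) :=
    Nat.Coprime.pow_right k ((Nat.Prime.coprime_iff_not_dvd Nat.prime_three).2 hj3).symm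
  have hcop : Nat.Coprime j (3 ^ k / 3) :=
    Nat.Coprime.coprime_dvd_right (Nat.div_dvd_of_dvd (dvd_pow_self 3 hk.ne')) hcop3k
  have h6j : 6 * j ≠ 3 ^ k := fun h6 ↦ by
    have h2 : Nat.Coprime 2 (3 ^ k) := Nat.Coprime.pow_right k (by norm_num)
    have := h2.eq_one_of_dvd ⟨3 * j, by omega⟩
    omega
  exact ⟨σ, Or.inr (Or.inr ⟨3 ^ k / 3, j, hd3.symm, hj1, hjd, hcop, h6j, fun l ↦ by rw [h l]; rfl⟩)⟩

end ThreePow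

/-! ## Level `m = 2ⁿ`: Theorem 6 (c) -/

section TwoPow

variable {k : ℕ}

/-- `d = m/2` as a residue modulo `m = 2ᵏ`. -/
local notation "𝔢" => (((2 ^ k / 2 : ℕ) : ZMod (2 ^ k)))

/-- **Shioda's standard element `αᵢ = (i, m′ + i, m − 2i, m′)`** of level `m = 2m′` (Lemma 1 (a)), here at `m = 2ᵏ`
(`m′ = d = 2ᵏ⁻¹`), for an arbitrary residue `i = c`; its multiset of values is Aoki's `σ_{2,c} = {c, c + d, −2c, d}`.
[cite: Shioda1982PicardFermat, §4 Lemma 1 (a) p. 728] -/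
def alphaStd (c : ZMod (2 ^ k)) : Fin 4 → ZMod (2 ^ k) := ![c, 𝔢 + c, -(2 * c), 𝔢]

/-- **Shioda's standard element `βᵢ = (i, m′ + i, m′ + 2i, m − 4i)`** of level `m = 2m′` (Lemma 1 (a); the second printed
form `(i, m′ + i, 2i − m′, 2m − 4i)` for `i > m′/2` is the same vector of residues), here at `m = 2ᵏ`, for an arbitrary
residue `i = c`. [cite: Shioda1982PicardFermat, §4 Lemma 1 (a) p. 728] -/
def betaStd (c : ZMod (2 ^ k)) : Fin 4 → ZMod (2 ^ k) := ![c, 𝔢 + c, 𝔢 + 2 * c, -(4 * c)]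

/-- The multiset of values of `α_c` is `σ_{2,c} = {c, c + d} + {−2c} + {d}` (the tree's spelling).
[cite: Shioda1982PicardFermat, §4 Lemma 1 (a) p. 728] -/
theorem univ_val_map_alphaStd (c : ZMod (2 ^ k)) :
    univ.val.map (alphaStd c) =
      (Multiset.range 2).map (fun i : ℕ ↦ c + (i : ZMod (2 ^ k)) * 𝔢) + {-(((2 : ℕ) : ZMod (2 ^ k)) * c)} + {𝔢} := by
  have e1 : univ.val.map (alphaStd c) = {c, 𝔢 + c, -(2 * c), 𝔢} := by
    simp [alphaStd, Fin.univ_val_map]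
    rfl
  have e2 : (Multiset.range 2).map (fun i : ℕ ↦ c + (i : ZMod (2 ^ k)) * 𝔢) = {𝔢 + c, c} := by
    simp [Multiset.range_succ, add_comm]
  rw [e1, e2, Nat.cast_ofNat]
  simp only [Multiset.insert_eq_cons, Multiset.cons_add, Multiset.singleton_add]
  rw [Multiset.cons_swap (𝔢 + c) c]

/-- The multiset of values of `β_c` is `{c, c + d} + {d + 2c} + {−4c}`. [cite: Shioda1982PicardFermat, §4 Lemma 1 (a) p. 728] -/
theorem univ_val_map_betaStd (c : ZMod (2 ^ k)) :
    univ.val.map (betaStd c) =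
      (Multiset.range 2).map (fun i : ℕ ↦ c + (i : ZMod (2 ^ k)) * 𝔢) + {𝔢 + 2 * c} + {-(4 * c)} := by
  have e1 : univ.val.map (betaStd c) = {c, 𝔢 + c, 𝔢 + 2 * c, -(4 * c)} := by
    simp [betaStd, Fin.univ_val_map]
    rfl
  have e2 : (Multiset.range 2).map (fun i : ℕ ↦ c + (i : ZMod (2 ^ k)) * 𝔢) = {𝔢 + c, c} := by
    simp [Multiset.range_succ, add_comm]
  rw [e1, e2]
  simp only [Multiset.insert_eq_cons, Multiset.cons_add, Multiset.singleton_add]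
  rw [Multiset.cons_swap (𝔢 + c) c]

/-- `2 d = 0` in `ℤ/2ᵏ`. [folklore] -/
private theorem two_mul_e (hk : 0 < k) : ((2 : ℕ) : ZMod (2 ^ k)) * 𝔢 = 0 := p_mul_natCast_div (p := 2) hk

/-- `−d = d` in `ℤ/2ᵏ`. [folklore] -/
private theorem neg_e (hk : 0 < k) : -𝔢 = 𝔢 := neg_natCast_div (p := 2) hk rfl

/-- The kernel of multiplication by `2` on `ℤ/2ᵏ` is `{0, d}`. [folklore] -/
private theorem eq_zero_or_eq_e (hk : 0 < k) {z : ZMod (2 ^ k)} (hz : ((2 : ℕ) : ZMod (2 ^ k)) * z = 0) :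
    z = 0 ∨ z = 𝔢 := by
  obtain ⟨i, hi, rfl⟩ := exists_eq_mul_of_p_mul_eq_zero Nat.prime_two hk hz
  interval_cases i
  · left; simp
  · right; rw [Nat.cast_one, one_mul]

/-- An odd integral function on `ℤ/2ᵏ` vanishes at `0` and at `d = −d`. [folklore] -/
private theorem odd_zero_e (hk : 0 < k) {b : ZMod (2 ^ k) → ℤ} (hodd : ∀ w, b (-w) = -b w) :
    b 0 = 0 ∧ b 𝔢 = 0 := by
  constructor
  · have := hodd 0; rw [neg_zero] at this; omega
  · have := hodd 𝔢; rw [neg_e hk] at this; omega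

/-- `prog c + {z} ≤ s` when the members of the progression and `z ∉ prog c` occur in `s`. [folklore] -/
private theorem prog_add_singleton_le {p : ℕ} (hp : p.Prime) (hk : 0 < k) {s : Multiset (ZMod (p ^ k))}
    (c z : ZMod (p ^ k)) (h : ∀ x, (p : ZMod (p ^ k)) * x = (p : ZMod (p ^ k)) * c → 1 ≤ count x s)
    (hz : 1 ≤ count z s) (hzc : (p : ZMod (p ^ k)) * z ≠ (p : ZMod (p ^ k)) * c) :
    (Multiset.range p).map (fun i : ℕ ↦ c + (i : ZMod (p ^ k)) * ((p ^ k / p : ℕ) : ZMod (p ^ k))) + {z} ≤ s := by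
  classical
  rw [Multiset.le_iff_count]
  intro x
  rw [Multiset.count_add, count_range_map hp hk, Multiset.count_singleton]
  by_cases hx : x = z
  · subst hx
    rw [if_neg hzc, if_pos rfl]
    exact hz
  · rw [if_neg hx, add_zero]
    split_ifs with hxc
    · exact h x hxc
    · exact Nat.zero_le _

/-- The cousins `y` (`2y = w + d`) of a deepest element `w ∉ {0, d}` of the support of `b` lie outside the support
(`w` has valuation `≤ k − 2`, so `2^{v+1} ∣ d`). [folklore] -/
private theorem eq_zero_of_two_mul_eq_add_e (hk : 0 < k) {b : ZMod (2 ^ k) → ℤ} {v : ℕ} {w : ZMod (2 ^ k)}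
    (hw : b w ≠ 0) (hv : ¬ 2 ^ (v + 1) ∣ w.val) (hmin : ∀ x, b x ≠ 0 → 2 ^ v ∣ x.val) (hvk : v < k)
    (hw2 : 2 ∣ w.val) (hwd : w ≠ 𝔢) {y : ZMod (2 ^ k)} (hy : ((2 : ℕ) : ZMod (2 ^ k)) * y = w + 𝔢) :
    b y = 0 := by
  by_contra hy0
  have hd : 2 * (2 ^ k / 2) = 2 ^ k := Nat.mul_div_cancel' (dvd_pow_self 2 hk.ne')
  have hpos : 0 < 2 ^ k := by positivity
  have hk1 : 2 ^ k = 2 * 2 ^ (k - 1) := by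
    rw [← pow_succ']
    congr 1
    omega
  have hdval : (𝔢 : ZMod (2 ^ k)).val = 2 ^ k / 2 := by
    rw [ZMod.val_natCast, Nat.mod_eq_of_lt]
    omega
  -- `v + 1 ≤ k - 1`
  have hv1 : 1 ≤ v := by
    by_contra h
    have h0 : v = 0 := by omega
    rw [h0, zero_add, pow_one] at hv
    exact hv hw2
  have hwval : ¬ 2 ^ (k - 1) ∣ w.val := by
    rintro ⟨q, hq⟩
    have hlt : w.val < 2 ^ k := ZMod.val_lt w
    have hq2 : q < 2 := by
      by_contra hq2
      have : 2 ^ (k - 1) * 2 ≤ 2 ^ (k - 1) * q := Nat.mul_le_mul_left _ (by omega)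
      omega
    interval_cases q
    · rw [mul_zero] at hq
      exact hv (hq ▸ dvd_zero _)
    · apply hwd
      rw [← ZMod.natCast_zmod_val w, hq, mul_one]
      congr 1
      rw [hk1]
      omega
  have hvk1 : v + 1 ≤ k - 1 := by
    by_contra h
    have hle : k - 1 ≤ v := by omega
    exact hwval (Nat.dvd_trans (pow_dvd_pow 2 hle) (hmin w hw))
  have hdvd_d : 2 ^ (v + 1) ∣ 2 ^ k / 2 := by
    have : 2 ^ k / 2 = 2 ^ (k - 1) := by omega
    rw [this]
    exact pow_dvd_pow 2 hvk1
  have hdvd_m : 2 ^ (v + 1) ∣ 2 ^ k := pow_dvd_pow 2 (by omega)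
  -- `2^{v+1} ∣ ⟨2y⟩ = ⟨w + d⟩`
  have h1 : 2 ^ (v + 1) ∣ 2 * y.val := by
    rw [pow_succ']
    exact Nat.mul_dvd_mul_left 2 (hmin y hy0)
  have h2y : (((2 : ℕ) : ZMod (2 ^ k)) * y).val = (2 * y.val) % 2 ^ k := by
    rw [← ZMod.natCast_zmod_val y, ← Nat.cast_mul, ZMod.val_natCast, ZMod.natCast_zmod_val]
  have h2 : 2 ^ (v + 1) ∣ (w + 𝔢).val := by
    rw [← hy, h2y]
    exact (Nat.dvd_mod_iff hdvd_m).mpr h1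
  rw [ZMod.val_add, hdval, Nat.dvd_mod_iff hdvd_m] at h2
  exact hv ((Nat.dvd_add_left hdvd_d).mp h2)

/-- **Theorem 6 (c), multiset form**: at level `m = 2ᵏ` the multiset of values of an indecomposable `α ∈ 𝔅²ₘ` is either
`σ_{2,c} = {c, c + d, −2c, d}` with `2c ∉ {0, d}` (an `α`-type standard element) or `{c, c + d, d + 2c, −4c}` with
`4c ∉ {0, d}` (a `β`-type standard element). PROOF (not Shioda's): odd-part / level-lowering as in `eq_pStandard_of_not_symmetric`,
with a deepest element `w = 2c` of the support of `b`, `b(w) > 0`, and the case distinction `b(2w) ≤ 0` (then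
`−w ∈ s`: type `α`), `b(2w) > 0 ≥ b(w + d)` (then `w + d ∈ s`: type `β`), `b(2w), b(w + d) > 0` (impossible: the four
residues over `w` and `w + d` would exhaust `s`, contradicting `Σ s = 0`). [cite: Shioda1982PicardFermat, Thm 6 (c) p. 731] -/
theorem map_eq_std_of_indecomposable_two (hk : 0 < k) {α : Fin 4 → ZMod (2 ^ k)} (hα : IsHodge α)
    (hind : ∀ i j : Fin 4, i ≠ j → α i + α j ≠ 0) :
    ∃ c : ZMod (2 ^ k),
      (((2 : ℕ) : ZMod (2 ^ k)) * c ≠ 0 ∧ ((2 : ℕ) : ZMod (2 ^ k)) * c ≠ 𝔢 ∧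
        univ.val.map α = (Multiset.range 2).map (fun i : ℕ ↦ c + (i : ZMod (2 ^ k)) * 𝔢)
          + {-(((2 : ℕ) : ZMod (2 ^ k)) * c)} + {𝔢}) ∨
      (((2 : ℕ) : ZMod (2 ^ k)) * (2 * c) ≠ 0 ∧ ((2 : ℕ) : ZMod (2 ^ k)) * (2 * c) ≠ 𝔢 ∧
        univ.val.map α = (Multiset.range 2).map (fun i : ℕ ↦ c + (i : ZMod (2 ^ k)) * 𝔢)
          + {𝔢 + 2 * c} + {-(4 * c)}) := by
  classical
  set s := univ.val.map α with hsdef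
  have hs : IsHodgeMultiset s := hα.isHodgeMultiset
  have hcard : Multiset.card s = 4 := by simp [hsdef]
  have hde : (𝔢 : ZMod (2 ^ k)) ≠ 0 := natCast_div_ne_zero Nat.prime_two hk
  -- `s` is not negation-symmetric
  have hns : ∃ x, count x s ≠ count (-x) s := by
    by_contra h
    push Not at h
    have hx0 : α 0 ≠ 0 := hα.1.1 0
    have hmem : α 0 ∈ s := Multiset.mem_map.mpr ⟨0, Finset.mem_univ_val 0, rfl⟩
    by_cases hxx : α 0 = -α 0
    · -- `α 0 = d`: a second coordinate equals `d`, or the other three form a symmetric multiset of odd size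
      obtain ⟨t, ht⟩ := Multiset.exists_cons_of_mem hmem
      by_cases hj : ∃ j, j ≠ 0 ∧ α j = α 0
      · obtain ⟨j, hj0, hj⟩ := hj
        exact hind 0 j hj0.symm (by rw [hj]; nth_rw 2 [hxx]; exact add_neg_cancel _)
      · push Not at hj
        have hcount : count (α 0) s = 1 := by
          rw [hsdef, count_univ_val_map]
          rw [Finset.card_eq_one]
          refine ⟨0, ?_⟩
          ext i
          simp only [Finset.mem_filter, Finset.mem_univ, true_and, Finset.mem_singleton]
          exact ⟨fun hi ↦ by_contra fun hi0 ↦ hj i hi0 hi, fun hi ↦ by rw [hi]⟩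
        have ht0 : count (α 0) t = 0 := by
          have := hcount
          rw [ht, Multiset.count_cons_self] at this
          omega
        have htsym : ∀ y, count (-y) t = count y t := by
          intro y
          by_cases hy : y = α 0
          · rw [hy, ← hxx]
          · have hy' : -y ≠ α 0 := fun e ↦ hy (by rw [← neg_neg y, e, ← hxx])
            have e1 : count y s = count y t := by rw [ht, Multiset.count_cons_of_ne hy]
            have e2 : count (-y) s = count (-y) t := by rw [ht, Multiset.count_cons_of_ne hy']
            rw [← e1, ← e2, h y]
        have htne : ∀ y ∈ t, y ≠ -y := by
          intro y hy e
          have hy0 : y ≠ 0 := hs.1.1 y (by rw [ht]; exact Multiset.mem_cons_of_mem hy)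
          have hyd := (eq_half_of_eq_neg Nat.prime_two hk e hy0).2
          have hxd := (eq_half_of_eq_neg Nat.prime_two hk hxx hx0).2
          have : y = α 0 := by rw [hyd, hxd]
          rw [this] at hy
          exact (Multiset.count_eq_zero.mp ht0) hy
        have heven := even_card_of_symm t htsym htne
        have hct : Multiset.card t = 3 := by
          have := hcard
          rw [ht, Multiset.card_cons] at this
          omega
        rw [hct] at heven
        exact absurd heven (by decide)
    · have hmem' : -α 0 ∈ s := by
        rw [← Multiset.count_pos, ← h, Multiset.count_pos]
        exact hmem
      obtain ⟨j, -, hj⟩ := Multiset.mem_map.mp hmem'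
      have hj0 : j ≠ 0 := by
        rintro rfl
        exact hxx hj
      exact hind 0 j hj0.symm (by rw [hj, add_neg_cancel])
  -- the odd function `b` and a deepest element `w = 2c` of its support with `b w > 0`
  obtain ⟨b, hodd, hsupp, hb⟩ := exists_int_odd Nat.prime_two hk hs
  have hb0 : ∃ x, b x ≠ 0 := by
    by_contra h
    push Not at h
    obtain ⟨x, hx⟩ := hns
    have := hb x
    rw [h, h, sub_self, sub_eq_zero] at this
    exact hx (by exact_mod_cast this)
  obtain ⟨h00, hd0⟩ := odd_zero_e hk hodd
  obtain ⟨v, w, hw, hv, hmin, hvk⟩ := exists_deepest_pos Nat.prime_two hodd hb0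
  have hw0 : w ≠ 0 := fun e ↦ by rw [e, h00] at hw; exact lt_irrefl _ hw
  have hwd : w ≠ 𝔢 := fun e ↦ by rw [e, hd0] at hw; exact lt_irrefl _ hw
  have hw2 : 2 ∣ w.val := hsupp w hw.ne'
  obtain ⟨j, hj⟩ := hw2
  set c : ZMod (2 ^ k) := (j : ZMod (2 ^ k)) with hc
  have hpc : ((2 : ℕ) : ZMod (2 ^ k)) * c = w := by
    rw [hc, ← Nat.cast_mul, ← hj, ZMod.natCast_zmod_val]
  have h2e := two_mul_e hk
  have hne := neg_e hk
  -- sum of the progression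
  have hsumprog : ((Multiset.range 2).map (fun i : ℕ ↦ c + (i : ZMod (2 ^ k)) * 𝔢)).sum =
      ((2 : ℕ) : ZMod (2 ^ k)) * c + 𝔢 := by
    have hstd := sum_std (p := 2) Nat.prime_two hk c
    rw [if_pos rfl, Multiset.sum_add, Multiset.sum_add, Multiset.sum_singleton, Multiset.sum_singleton] at hstd
    have e : ((Multiset.range 2).map (fun i : ℕ ↦ c + (i : ZMod (2 ^ k)) * 𝔢)).sum =
        -(-(((2 : ℕ) : ZMod (2 ^ k)) * c)) - 𝔢 := by linear_combination hstd
    rw [e, neg_neg, sub_eq_add_neg, hne]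
  -- the children of `w` occur at least `b w` times
  have hchild : ∀ x, ((2 : ℕ) : ZMod (2 ^ k)) * x = ((2 : ℕ) : ZMod (2 ^ k)) * c → (b w : ℤ) ≤ count x s := by
    intro x hx
    rw [hpc] at hx
    have hx0 : b x = 0 := eq_zero_of_p_mul_eq Nat.prime_two hv hmin hvk hx
    have := hb x
    rw [hx, hx0, sub_zero] at this
    have : (0 : ℤ) ≤ count (-x) s := by positivity
    omega
  have hchild1 : ∀ x, ((2 : ℕ) : ZMod (2 ^ k)) * x = ((2 : ℕ) : ZMod (2 ^ k)) * c → 1 ≤ count x s := by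
    intro x hx
    have := hchild x hx
    omega
  have h2w0 : ((2 : ℕ) : ZMod (2 ^ k)) * w ≠ 0 := fun e ↦ by
    rcases eq_zero_or_eq_e hk e with h | h
    · exact hw0 h
    · exact hwd h
  -- `b w = 1`
  have hbw : b w = 1 := by
    by_contra hbw
    have hbw2 : 2 ≤ b w := by omega
    have hle : (Multiset.range 2).map (fun i : ℕ ↦ c + (i : ZMod (2 ^ k)) * 𝔢)
        + (Multiset.range 2).map (fun i : ℕ ↦ c + (i : ZMod (2 ^ k)) * 𝔢) ≤ s := by
      rw [Multiset.le_iff_count]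
      intro x
      rw [Multiset.count_add, count_range_map Nat.prime_two hk]
      split_ifs with hx
      · have := hchild x hx
        omega
      · exact Nat.zero_le _
    have heq := Multiset.eq_of_le_of_card_le hle (by
      rw [hcard, Multiset.card_add, Multiset.card_map, Multiset.card_range])
    have hsum := hs.1.2
    rw [← heq, Multiset.sum_add, hsumprog, hpc] at hsum
    apply h2w0
    linear_combination hsum - h2e
  by_cases hA : b (((2 : ℕ) : ZMod (2 ^ k)) * w) ≤ 0
  · -- type `α`: `-w ∈ s`
    have hnegw : 1 ≤ count (-w) s := by
      have := hb (-w)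
      rw [mul_neg, hodd, hodd, neg_neg, hbw] at this
      have : (0 : ℤ) ≤ count (- -w) s := by positivity
      omega
    have hzc : ((2 : ℕ) : ZMod (2 ^ k)) * (-w) ≠ ((2 : ℕ) : ZMod (2 ^ k)) * c := by
      rw [hpc, mul_neg]
      intro e
      have h3 : ((3 : ℕ) : ZMod (2 ^ k)) * w = 0 := by
        push_cast at e ⊢
        linear_combination -e
      exact hw0 (eq_zero_of_coprime_mul (p := 2) (Nat.Coprime.pow_right k (by norm_num)) h3)
    obtain ⟨t, ht⟩ := Multiset.le_iff_exists_add.mp (prog_add_singleton_le Nat.prime_two hk c (-w) hchild1 hnegw hzc)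
    have hct : Multiset.card t = 1 := by
      have := congrArg Multiset.card ht
      rw [hcard, Multiset.card_add, Multiset.card_add, Multiset.card_map, Multiset.card_range,
        Multiset.card_singleton] at this
      omega
    obtain ⟨z, rfl⟩ := Multiset.card_eq_one.mp hct
    have hsum := hs.1.2
    rw [ht, Multiset.sum_add, Multiset.sum_add, Multiset.sum_singleton, Multiset.sum_singleton, hsumprog, hpc] at hsum
    have hz : z = 𝔢 := by
      rw [← hne]
      linear_combination hsum
    refine ⟨c, Or.inl ⟨by rwa [hpc], by rwa [hpc], ?_⟩⟩
    rw [ht, hz, hpc]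
  · push Not at hA
    have h2w_d : ((2 : ℕ) : ZMod (2 ^ k)) * w ≠ 𝔢 := fun e ↦ by
      rw [e, hd0] at hA
      exact lt_irrefl _ hA
    have h2we : ((2 : ℕ) : ZMod (2 ^ k)) * (w + 𝔢) = ((2 : ℕ) : ZMod (2 ^ k)) * w := by
      rw [mul_add, h2e, add_zero]
    by_cases hB : b (w + 𝔢) ≤ 0
    · -- type `β`: `w + d ∈ s`
      have hwd1 : 1 ≤ count (w + 𝔢) s := by
        have := hb (w + 𝔢)
        rw [h2we] at this
        have : (0 : ℤ) ≤ count (-(w + 𝔢)) s := by positivity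
        omega
      have hzc : ((2 : ℕ) : ZMod (2 ^ k)) * (w + 𝔢) ≠ ((2 : ℕ) : ZMod (2 ^ k)) * c := by
        rw [h2we, hpc]
        intro e
        apply hw0
        linear_combination e
      obtain ⟨t, ht⟩ := Multiset.le_iff_exists_add.mp
        (prog_add_singleton_le Nat.prime_two hk c (w + 𝔢) hchild1 hwd1 hzc)
      have hct : Multiset.card t = 1 := by
        have := congrArg Multiset.card ht
        rw [hcard, Multiset.card_add, Multiset.card_add, Multiset.card_map, Multiset.card_range,
          Multiset.card_singleton] at this
        omega
      obtain ⟨z, rfl⟩ := Multiset.card_eq_one.mp hct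
      have hsum := hs.1.2
      rw [ht, Multiset.sum_add, Multiset.sum_add, Multiset.sum_singleton, Multiset.sum_singleton, hsumprog, hpc]
        at hsum
      have hz : z = -(4 * c) := by
        have e4 : (4 : ZMod (2 ^ k)) * c = ((2 : ℕ) : ZMod (2 ^ k)) * w := by
          rw [← hpc]
          push_cast
          ring
        rw [e4]
        linear_combination hsum - h2e
      have hwc : w + 𝔢 = 𝔢 + 2 * c := by
        rw [← hpc]
        push_cast
        ring
      have hpc2 : (2 : ZMod (2 ^ k)) * c = w := by
        have := hpc
        simp only [Nat.cast_ofNat] at this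
        exact this
      refine ⟨c, Or.inr ⟨?_, ?_, ?_⟩⟩
      · rw [hpc2]
        exact h2w0
      · rw [hpc2]
        exact h2w_d
      · rw [ht, hz, hwc]
    · -- both `2w` and `w + d` carry positive charge: impossible
      push Not at hB
      exact absurd hB (by
        intro hB
        obtain ⟨j', hj'⟩ := hsupp (w + 𝔢) hB.ne'
        set c' : ZMod (2 ^ k) := (j' : ZMod (2 ^ k)) with hc'
        have hpc' : ((2 : ℕ) : ZMod (2 ^ k)) * c' = w + 𝔢 := by
          rw [hc', ← Nat.cast_mul, ← hj', ZMod.natCast_zmod_val]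
        have hcous : ∀ x, ((2 : ℕ) : ZMod (2 ^ k)) * x = ((2 : ℕ) : ZMod (2 ^ k)) * c' → 1 ≤ count x s := by
          intro x hx
          rw [hpc'] at hx
          have hx0 : b x = 0 := eq_zero_of_two_mul_eq_add_e hk hw.ne' hv hmin hvk ⟨j, hj⟩ hwd hx
          have := hb x
          rw [hx, hx0, sub_zero] at this
          have : (0 : ℤ) ≤ count (-x) s := by positivity
          omega
        have hcc' : ((2 : ℕ) : ZMod (2 ^ k)) * c ≠ ((2 : ℕ) : ZMod (2 ^ k)) * c' := by
          rw [hpc, hpc']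
          intro e
          apply hde
          linear_combination -e
        have hle : (Multiset.range 2).map (fun i : ℕ ↦ c + (i : ZMod (2 ^ k)) * 𝔢)
            + (Multiset.range 2).map (fun i : ℕ ↦ c' + (i : ZMod (2 ^ k)) * 𝔢) ≤ s := by
          rw [Multiset.le_iff_count]
          intro x
          rw [Multiset.count_add, count_range_map Nat.prime_two hk, count_range_map Nat.prime_two hk]
          by_cases hx : ((2 : ℕ) : ZMod (2 ^ k)) * x = ((2 : ℕ) : ZMod (2 ^ k)) * c
          · rw [if_pos hx, if_neg (fun e ↦ hcc' (hx.symm.trans e)), add_zero]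
            exact hchild1 x hx
          · rw [if_neg hx, zero_add]
            split_ifs with hx'
            · exact hcous x hx'
            · exact Nat.zero_le _
        have heq := Multiset.eq_of_le_of_card_le hle (by
          rw [hcard, Multiset.card_add, Multiset.card_map, Multiset.card_map, Multiset.card_range])
        have hsumprog' : ((Multiset.range 2).map (fun i : ℕ ↦ c' + (i : ZMod (2 ^ k)) * 𝔢)).sum =
            ((2 : ℕ) : ZMod (2 ^ k)) * c' + 𝔢 := by
          have hstd := sum_std (p := 2) Nat.prime_two hk c'
          rw [if_pos rfl, Multiset.sum_add, Multiset.sum_add, Multiset.sum_singleton, Multiset.sum_singleton] at hstd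
          have e : ((Multiset.range 2).map (fun i : ℕ ↦ c' + (i : ZMod (2 ^ k)) * 𝔢)).sum =
              -(-(((2 : ℕ) : ZMod (2 ^ k)) * c')) - 𝔢 := by linear_combination hstd
          rw [e, neg_neg, sub_eq_add_neg, hne]
        have hsum := hs.1.2
        rw [← heq, Multiset.sum_add, hsumprog, hsumprog', hpc, hpc'] at hsum
        apply h2w_d
        rw [← hne]
        linear_combination hsum - h2e)

/-- `3` is prime to `2ᵏ`: `3 w = 0` forces `w = 0`. [folklore] -/
private theorem eq_zero_of_three_mul {w : ZMod (2 ^ k)} (h : (3 : ZMod (2 ^ k)) * w = 0) : w = 0 := by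
  refine eq_zero_of_coprime_mul (p := 2) (n := 3) (Nat.Coprime.pow_right k (by norm_num)) ?_
  simpa using h

/-- **`α_c ∈ 𝔅²ₘ`** (`m = 2ᵏ`, `2c ≠ 0`). [cite: Shioda1982PicardFermat, §4 Lemma 1 (a) p. 728] -/
theorem isHodge_alphaStd (hk : 0 < k) {c : ZMod (2 ^ k)} (hc : 2 * c ≠ 0) : IsHodge (alphaStd c) := by
  rw [isHodge_iff_isHodgeMultiset, univ_val_map_alphaStd]
  have hc' : ((2 : ℕ) : ZMod (2 ^ k)) * c ≠ 0 := by rwa [Nat.cast_ofNat]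
  have h := isHodgeMultiset_std (p := 2) Nat.prime_two hk hc'
  rwa [if_pos rfl] at h

/-- **`α_c` is indecomposable** when `2c ∉ {0, d}` (i.e. `4c ≠ 0`; Shioda's side condition `i ≠ m/4`).
[cite: Shioda1982PicardFermat, §4 Lemma 1 (a) p. 728] -/
theorem alphaStd_add_ne_zero (hk : 0 < k) {c : ZMod (2 ^ k)} (hc : 2 * c ≠ 0) (hcd : 2 * c ≠ 𝔢) :
    ∀ i j : Fin 4, i ≠ j → alphaStd c i + alphaStd c j ≠ 0 := by
  have hd : (2 : ZMod (2 ^ k)) * 𝔢 = 0 := by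
    have := two_mul_e (k := k) hk
    rwa [Nat.cast_ofNat] at this
  have hde : (𝔢 : ZMod (2 ^ k)) ≠ 0 := natCast_div_ne_zero Nat.prime_two hk
  have hc0 : c ≠ 0 := fun e ↦ hc (by rw [e, mul_zero])
  have hcd' : c ≠ 𝔢 := fun e ↦ hc (by rw [e, hd])
  intro i j hij h
  fin_cases i <;> fin_cases j <;> simp [alphaStd] at hij h ⊢
  · exact hcd (by linear_combination h - hd)
  · exact hc0 (by linear_combination -h)
  · exact hcd' (by linear_combination h - hd)
  · exact hcd (by linear_combination h - hd)
  · exact hcd' (by linear_combination -h)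
  · exact hc0 (by linear_combination h - hd)
  · exact hc0 (by linear_combination -h)
  · exact hcd' (by linear_combination -h)
  · exact hcd (by linear_combination -h)
  · exact hcd' (by linear_combination h - hd)
  · exact hc0 (by linear_combination h - hd)
  · exact hcd (by linear_combination -h)

/-- The multiset identity behind `β_c`: `β_c + {2c, −2c} + {d, −d} ∼ σ_{2,c} ∗ σ_{2,2c}` (so `β_c` is Hodge iff
`σ_{2,c}`, `σ_{2,2c}` are: "`β_i`" is, up to pairs, a juxtaposition of two `α`'s). [folklore] -/
private theorem pairs_add_map_betaStd (hk : 0 < k) (c : ZMod (2 ^ k)) :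
    ({2 * c, -(2 * c)} + {(𝔢 : ZMod (2 ^ k)), -𝔢} : Multiset (ZMod (2 ^ k))) + univ.val.map (betaStd c) =
      ((Multiset.range 2).map (fun i : ℕ ↦ c + (i : ZMod (2 ^ k)) * 𝔢) + {-(((2 : ℕ) : ZMod (2 ^ k)) * c)} + {𝔢}) +
      ((Multiset.range 2).map (fun i : ℕ ↦ 2 * c + (i : ZMod (2 ^ k)) * 𝔢)
        + {-(((2 : ℕ) : ZMod (2 ^ k)) * (2 * c))} + {𝔢}) := by
  rw [univ_val_map_betaStd, neg_e hk]
  have e4 : ((2 : ℕ) : ZMod (2 ^ k)) * (2 * c) = 4 * c := by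
    push_cast
    ring
  rw [e4, add_comm (𝔢 : ZMod (2 ^ k)) (2 * c)]
  simp only [Multiset.range_succ, Multiset.range_zero, Multiset.map_cons, Multiset.map_zero, Nat.cast_zero,
    Nat.cast_one, zero_mul, one_mul, add_zero, Nat.cast_ofNat]
  simp only [Multiset.insert_eq_cons, ← Multiset.singleton_add, add_zero]
  abel

/-- **`β_c ∈ 𝔅²ₘ`** (`m = 2ᵏ`, `4c ≠ 0`). [cite: Shioda1982PicardFermat, §4 Lemma 1 (a) p. 728] -/
theorem isHodge_betaStd (hk : 0 < k) {c : ZMod (2 ^ k)} (hc : 4 * c ≠ 0) : IsHodge (betaStd c) := by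
  have h2c : ((2 : ℕ) : ZMod (2 ^ k)) * c ≠ 0 := by
    intro e
    apply hc
    have : (4 : ZMod (2 ^ k)) * c = 2 * (((2 : ℕ) : ZMod (2 ^ k)) * c) := by
      push_cast
      ring
    rw [this, e, mul_zero]
  have h4c : ((2 : ℕ) : ZMod (2 ^ k)) * (2 * c) ≠ 0 := by
    intro e
    apply hc
    have : (4 : ZMod (2 ^ k)) * c = ((2 : ℕ) : ZMod (2 ^ k)) * (2 * c) := by
      push_cast
      ring
    rw [this, e]
  have h2c' : (2 : ZMod (2 ^ k)) * c ≠ 0 := by rwa [Nat.cast_ofNat] at h2c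
  have hσ1 := isHodgeMultiset_std (p := 2) Nat.prime_two hk h2c
  have hσ2 := isHodgeMultiset_std (p := 2) Nat.prime_two hk h4c
  rw [if_pos rfl] at hσ1 hσ2
  have hP : IsHodgeMultiset (({2 * c, -(2 * c)} + {(𝔢 : ZMod (2 ^ k)), -𝔢} : Multiset (ZMod (2 ^ k)))) :=
    (IsHodgeMultiset.pair h2c').add (IsHodgeMultiset.pair (natCast_div_ne_zero Nat.prime_two hk))
  rw [isHodge_iff_isHodgeMultiset]
  refine IsHodgeMultiset.of_add_left ?_ hP
  rw [pairs_add_map_betaStd hk c]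
  exact hσ1.add hσ2

/-- **`β_c` is indecomposable** when `4c ≠ 0`. [cite: Shioda1982PicardFermat, §4 Lemma 1 (a) p. 728] -/
theorem betaStd_add_ne_zero (hk : 0 < k) {c : ZMod (2 ^ k)} (hc : 4 * c ≠ 0) :
    ∀ i j : Fin 4, i ≠ j → betaStd c i + betaStd c j ≠ 0 := by
  have hd : (2 : ZMod (2 ^ k)) * 𝔢 = 0 := by
    have := two_mul_e (k := k) hk
    rwa [Nat.cast_ofNat] at this
  have hc0 : c ≠ 0 := fun e ↦ hc (by rw [e, mul_zero])
  have h2c : 2 * c ≠ 0 := fun e ↦ hc (by linear_combination 2 * e)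
  intro i j hij h
  fin_cases i <;> fin_cases j <;> simp [betaStd] at hij h ⊢ <;>
    first
    | exact hc (by linear_combination 2 * h - hd)
    | exact hc (by linear_combination -2 * h + hd)
    | exact hc0 (eq_zero_of_three_mul (by linear_combination h))
    | exact hc0 (eq_zero_of_three_mul (by linear_combination -h))
    | exact hc0 (eq_zero_of_three_mul (by linear_combination h - hd))
    | exact hc0 (eq_zero_of_three_mul (by linear_combination -h + hd))
    | exact h2c (eq_zero_of_three_mul (by linear_combination 2 * h - hd))
    | exact h2c (eq_zero_of_three_mul (by linear_combination -2 * h + hd))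

/-- **Shioda 1982, Theorem 6 (c) (all `2`-power levels, permutation form).** Let `m = 2ᵏ`, `k ≥ 1`. Every indecomposable
`α ∈ 𝔅²ₘ` is a permutation of a standard element `α_c = (c, d + c, −2c, d)` with `2c ∉ {0, d}` or `β_c = (c, d + c, d + 2c, −4c)`
with `4c ∉ {0, d}` (`d = m/2`). Shioda (primitive `α`, `m = 2ⁿ`, `n ≥ 4`): "any element of `𝔍²ₘ(1)` is a permutation of one
of `αᵢ` or `βᵢ` (`1 ≤ i ≤ m/2`, `i` : odd) of Lemma 1"; PROOF here: `map_eq_std_of_indecomposable_two` (not Shioda's, who uses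
Koblitz–Rohrlich's Theorem at level `2ⁿ`). [cite: Shioda1982PicardFermat, Thm 6 (c) p. 731] -/
theorem exists_perm_alphaStd_or_betaStd (hk : 0 < k) {α : Fin 4 → ZMod (2 ^ k)} (hα : IsHodge α)
    (hind : ∀ i j : Fin 4, i ≠ j → α i + α j ≠ 0) :
    ∃ (c : ZMod (2 ^ k)) (σ : Equiv.Perm (Fin 4)),
      (2 * c ≠ 0 ∧ 2 * c ≠ 𝔢 ∧ ∀ i, α (σ i) = alphaStd c i) ∨
      (4 * c ≠ 0 ∧ 4 * c ≠ 𝔢 ∧ ∀ i, α (σ i) = betaStd c i) := by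
  classical
  obtain ⟨c, h⟩ := map_eq_std_of_indecomposable_two hk hα hind
  have e4 : ((2 : ℕ) : ZMod (2 ^ k)) * (2 * c) = 4 * c := by
    push_cast
    ring
  rcases h with ⟨h0, hd, hs⟩ | ⟨h0, hd, hs⟩
  · rw [← univ_val_map_alphaStd] at hs
    obtain ⟨σ, hσ⟩ := exists_perm_of_map_eq hs
    rw [Nat.cast_ofNat] at h0 hd
    exact ⟨c, σ, Or.inl ⟨h0, hd, fun i ↦ (congrFun hσ i).symm⟩⟩
  · rw [← univ_val_map_betaStd] at hs
    obtain ⟨σ, hσ⟩ := exists_perm_of_map_eq hs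
    rw [e4] at h0 hd
    exact ⟨c, σ, Or.inr ⟨h0, hd, fun i ↦ (congrFun hσ i).symm⟩⟩

/-- **Theorem 6 (c), characterisation**: at level `m = 2ᵏ` the indecomposable elements of `𝔅²ₘ` are EXACTLY the permutations
of the `α_c` (`2c ∉ {0, d}`) and of the `β_c` (`4c ∉ {0, d}`). [cite: Shioda1982PicardFermat, Thm 6 (c) p. 731 and Lemma 1 (a) p. 728] -/
theorem indecomposable_iff_two_pow (hk : 0 < k) (α : Fin 4 → ZMod (2 ^ k)) :
    (IsHodge α ∧ ∀ i j : Fin 4, i ≠ j → α i + α j ≠ 0) ↔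
      ∃ (c : ZMod (2 ^ k)) (σ : Equiv.Perm (Fin 4)),
        (2 * c ≠ 0 ∧ 2 * c ≠ 𝔢 ∧ ∀ i, α (σ i) = alphaStd c i) ∨
        (4 * c ≠ 0 ∧ 4 * c ≠ 𝔢 ∧ ∀ i, α (σ i) = betaStd c i) := by
  constructor
  · rintro ⟨hα, hind⟩
    exact exists_perm_alphaStd_or_betaStd hk hα hind
  · rintro ⟨c, σ, ⟨h0, hd, h⟩ | ⟨h0, hd, h⟩⟩
    · have e : α = alphaStd c ∘ σ.symm := by
        funext j
        rw [Function.comp_apply, ← h (σ.symm j), Equiv.apply_symm_apply]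
      refine ⟨e ▸ (isHodge_alphaStd hk h0).compEquiv σ.symm, fun i j hij ↦ ?_⟩
      rw [e]
      exact alphaStd_add_ne_zero hk h0 hd _ _ (σ.symm.injective.ne hij)
    · have e : α = betaStd c ∘ σ.symm := by
        funext j
        rw [Function.comp_apply, ← h (σ.symm j), Equiv.apply_symm_apply]
      refine ⟨e ▸ (isHodge_betaStd hk h0).compEquiv σ.symm, fun i j hij ↦ ?_⟩
      rw [e]
      exact betaStd_add_ne_zero hk h0 _ _ (σ.symm.injective.ne hij)


/-- The representative of a residue of `ℤ/2ᵏ` that is (plus or minus) the image of an even natural number is even (`k ≥ 1`).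
[folklore] -/
private theorem two_dvd_val_of_even (hk : 0 < k) {n : ℕ} (hn : 2 ∣ n) :
    2 ∣ ((n : ℕ) : ZMod (2 ^ k)).val ∧ 2 ∣ (-((n : ℕ) : ZMod (2 ^ k))).val := by
  have h2m : 2 ∣ 2 ^ k := dvd_pow_self 2 hk.ne'
  have h1 : 2 ∣ ((n : ℕ) : ZMod (2 ^ k)).val := by
    rw [ZMod.val_natCast]
    exact (Nat.dvd_mod_iff h2m).mpr hn
  refine ⟨h1, ?_⟩
  rw [ZMod.neg_val]
  split_ifs with h
  · exact dvd_zero 2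
  · exact Nat.dvd_sub h2m h1

/-- **Theorem 6 (c) in the printed normalisation.** At level `m = 2ᵏ`, an indecomposable `α ∈ 𝔅²ₘ` with `GCD(α) = 1` is a
permutation of `αᵢ = (i, m′ + i, m − 2i, m′)` or of `βᵢ = (i, m′ + i, m′ + 2i, m − 4i)` for some ODD integer `1 ≤ i < m′ = m/2`:
"any element of `𝔍²ₘ(1)` is a permutation of one of `αᵢ` or `βᵢ` (`1 ≤ i ≤ m/2`, `i` : odd) of Lemma 1." (Reduce `c` of
`exists_perm_alphaStd_or_betaStd` modulo `m′`: both multisets only depend on `2c`; if `i` is even every representative of `αᵢ`,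
`βᵢ` is even, as `m′` is even for `k ≥ 2`, and `k = 1` has no indecomposables.) [cite: Shioda1982PicardFermat, Thm 6 (c) p. 731] -/
theorem exists_perm_alphaStd_or_betaStd_lt (hk : 0 < k) {α : Fin 4 → ZMod (2 ^ k)} (hα : IsHodge α)
    (hind : ∀ i j : Fin 4, i ≠ j → α i + α j ≠ 0) (hprim : ∀ g : ℕ, (∀ i, g ∣ (α i).val) → g = 1) :
    ∃ (i : ℕ) (σ : Equiv.Perm (Fin 4)), 1 ≤ i ∧ i < 2 ^ k / 2 ∧ ¬ 2 ∣ i ∧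
      ((∀ l, α (σ l) = alphaStd (i : ZMod (2 ^ k)) l) ∨ (∀ l, α (σ l) = betaStd (i : ZMod (2 ^ k)) l)) := by
  classical
  obtain ⟨c, h⟩ := map_eq_std_of_indecomposable_two hk hα hind
  have hd2 : 2 * (2 ^ k / 2) = 2 ^ k := Nat.mul_div_cancel' (dvd_pow_self 2 hk.ne')
  have hpos : 0 < 2 ^ k := by positivity
  have hd0 : 0 < 2 ^ k / 2 := by omega
  -- `2c ≠ 0` in both cases
  have h2c : ((2 : ℕ) : ZMod (2 ^ k)) * c ≠ 0 := by
    rcases h with ⟨h0, -, -⟩ | ⟨h0, -, -⟩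
    · exact h0
    · intro e
      apply h0
      have : ((2 : ℕ) : ZMod (2 ^ k)) * (2 * c) = 2 * (((2 : ℕ) : ZMod (2 ^ k)) * c) := by ring
      rw [this, e, mul_zero]
  set i : ℕ := c.val % (2 ^ k / 2) with hidef
  have hilt : i < 2 ^ k / 2 := Nat.mod_lt _ hd0
  have hival : (i : ZMod (2 ^ k)).val = i := by
    rw [ZMod.val_natCast, Nat.mod_eq_of_lt (by omega)]
  have h2i : ((2 : ℕ) : ZMod (2 ^ k)) * (i : ZMod (2 ^ k)) = ((2 : ℕ) : ZMod (2 ^ k)) * c := by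
    rw [p_mul_eq_iff Nat.prime_two hk, hival, hidef, Nat.mod_mod]
  have hprog : (Multiset.range 2).map (fun l : ℕ ↦ (i : ZMod (2 ^ k)) + (l : ZMod (2 ^ k)) * 𝔢) =
      (Multiset.range 2).map (fun l : ℕ ↦ c + (l : ZMod (2 ^ k)) * 𝔢) := by
    rw [← filter_p_mul_eq_val Nat.prime_two hk c, ← filter_p_mul_eq_val Nat.prime_two hk (i : ZMod (2 ^ k)), h2i]
  have hi1 : 1 ≤ i := by
    by_contra h0
    have h00 : i = 0 := by omega
    rw [h00, Nat.cast_zero, mul_zero] at h2i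
    exact h2c h2i.symm
  -- `d` is even (the case `k = 1` is excluded by `2c ≠ 0`)
  have hk2 : 2 ≤ k := by
    by_contra hk1
    have hk1' : k = 1 := by omega
    subst hk1'
    apply h2c
    have : ((2 : ℕ) : ZMod (2 ^ 1)) = 0 := by decide
    rw [this, zero_mul]
  have hdeven : 2 ∣ 2 ^ k / 2 := by
    have h4 : 4 ∣ 2 ^ k := by
      have : 2 ^ 2 ∣ 2 ^ k := pow_dvd_pow 2 hk2
      simpa using this
    omega
  -- parity: if `i` is even, all representatives of `α_i`, `β_i` are even
  have hparA : 2 ∣ i → ∀ l : Fin 4, 2 ∣ (alphaStd (i : ZMod (2 ^ k)) l).val := by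
    intro hi l
    have e1 : (𝔢 : ZMod (2 ^ k)) + (i : ZMod (2 ^ k)) = ((2 ^ k / 2 + i : ℕ) : ZMod (2 ^ k)) := by push_cast; ring
    have e2 : -(2 * (i : ZMod (2 ^ k))) = -((2 * i : ℕ) : ZMod (2 ^ k)) := by push_cast; ring
    fin_cases l
    · simp only [alphaStd, Fin.zero_eta, Fin.isValue, Matrix.cons_val_zero]
      exact (two_dvd_val_of_even hk hi).1
    · simp only [alphaStd, Fin.mk_one, Fin.isValue, Matrix.cons_val_one, Matrix.cons_val_zero, e1]
      exact (two_dvd_val_of_even hk (Nat.dvd_add hdeven hi)).1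
    · simp only [alphaStd, Fin.reduceFinMk, Matrix.cons_val, e2]
      exact (two_dvd_val_of_even hk (dvd_mul_right 2 i)).2
    · simp only [alphaStd, Fin.reduceFinMk, Matrix.cons_val]
      exact (two_dvd_val_of_even hk hdeven).1
  have hparB : 2 ∣ i → ∀ l : Fin 4, 2 ∣ (betaStd (i : ZMod (2 ^ k)) l).val := by
    intro hi l
    have e1 : (𝔢 : ZMod (2 ^ k)) + (i : ZMod (2 ^ k)) = ((2 ^ k / 2 + i : ℕ) : ZMod (2 ^ k)) := by push_cast; ring
    have e2 : (𝔢 : ZMod (2 ^ k)) + 2 * (i : ZMod (2 ^ k)) = ((2 ^ k / 2 + 2 * i : ℕ) : ZMod (2 ^ k)) := by push_cast; ring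
    have e3 : -(4 * (i : ZMod (2 ^ k))) = -((4 * i : ℕ) : ZMod (2 ^ k)) := by push_cast; ring
    fin_cases l
    · simp only [betaStd, Fin.zero_eta, Fin.isValue, Matrix.cons_val_zero]
      exact (two_dvd_val_of_even hk hi).1
    · simp only [betaStd, Fin.mk_one, Fin.isValue, Matrix.cons_val_one, Matrix.cons_val_zero, e1]
      exact (two_dvd_val_of_even hk (Nat.dvd_add hdeven hi)).1
    · simp only [betaStd, Fin.reduceFinMk, Matrix.cons_val, e2]
      exact (two_dvd_val_of_even hk (Nat.dvd_add hdeven (dvd_mul_right 2 i))).1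
    · simp only [betaStd, Fin.reduceFinMk, Matrix.cons_val, e3]
      exact (two_dvd_val_of_even hk (Dvd.dvd.mul_left hi 4)).2
  rcases h with ⟨h0, hd, hs⟩ | ⟨h0, hd, hs⟩
  · -- type `α`
    have hsc' : univ.val.map α = univ.val.map (alphaStd (i : ZMod (2 ^ k))) := by
      rw [univ_val_map_alphaStd, hprog, h2i, hs]
    obtain ⟨σ, hσ⟩ := exists_perm_of_map_eq hsc'
    refine ⟨i, σ, hi1, hilt, fun hi ↦ ?_, Or.inl fun l ↦ (congrFun hσ l).symm⟩
    have h21 := hprim 2 fun l ↦ by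
      have e : α l = alphaStd (i : ZMod (2 ^ k)) (σ.symm l) := by
        have := congrFun hσ (σ.symm l)
        simp only [Function.comp_apply, Equiv.apply_symm_apply] at this
        exact this.symm
      rw [e]
      exact hparA hi _
    omega
  · -- type `β`
    have hsc' : univ.val.map α = univ.val.map (betaStd (i : ZMod (2 ^ k))) := by
      rw [univ_val_map_betaStd, hprog, hs]
      have e4 : (4 : ZMod (2 ^ k)) * (i : ZMod (2 ^ k)) = 4 * c := by
        have : (4 : ZMod (2 ^ k)) * (i : ZMod (2 ^ k)) = 2 * (((2 : ℕ) : ZMod (2 ^ k)) * (i : ZMod (2 ^ k))) := by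
          push_cast; ring
        rw [this, h2i]
        push_cast
        ring
      have e2 : (𝔢 : ZMod (2 ^ k)) + 2 * (i : ZMod (2 ^ k)) = 𝔢 + 2 * c := by
        have : (2 : ZMod (2 ^ k)) * (i : ZMod (2 ^ k)) = ((2 : ℕ) : ZMod (2 ^ k)) * (i : ZMod (2 ^ k)) := by push_cast; ring
        rw [this, h2i]
        push_cast
        ring
      rw [e4, e2]
    obtain ⟨σ, hσ⟩ := exists_perm_of_map_eq hsc'
    refine ⟨i, σ, hi1, hilt, fun hi ↦ ?_, Or.inr fun l ↦ (congrFun hσ l).symm⟩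
    have h21 := hprim 2 fun l ↦ by
      have e : α l = betaStd (i : ZMod (2 ^ k)) (σ.symm l) := by
        have := congrFun hσ (σ.symm l)
        simp only [Function.comp_apply, Equiv.apply_symm_apply] at this
        exact this.symm
      rw [e]
      exact hparB hi _
    omega

/-! ### Counting: Theorem 8 (i) -/

/-- The fibre `{x | 2x = w}` of multiplication by `2`. [folklore] -/
private def fibreTwo (w : ZMod (2 ^ k)) : Finset (ZMod (2 ^ k)) :=
  univ.filter fun x : ZMod (2 ^ k) ↦ ((2 : ℕ) : ZMod (2 ^ k)) * x = w

/-- `σ_{2, w/2}` as a function of `w ∈ 2ℤ/2ᵏ`: the fibre of `w`, plus `−w`, plus `d` (type `α`). [folklore] -/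
private def stdTwoA (w : ZMod (2 ^ k)) : Multiset (ZMod (2 ^ k)) := (fibreTwo w).val + {-w} + {𝔢}

/-- The `β`-type multiset as a function of `w = 2c`: the fibre of `w`, plus `w + d`, plus `−2w`. [folklore] -/
private def stdTwoB (w : ZMod (2 ^ k)) : Multiset (ZMod (2 ^ k)) :=
  (fibreTwo w).val + {w + 𝔢} + {-(((2 : ℕ) : ZMod (2 ^ k)) * w)}

/-- The multiples of `2` in `ℤ/2ᵏ`. [folklore] -/
private def evens (k : ℕ) : Finset (ZMod (2 ^ k)) := univ.filter fun w : ZMod (2 ^ k) ↦ 2 ∣ w.val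

/-- Parameters of the `α`-type multisets: `w ∈ 2ℤ/2ᵏ ∖ {0, d}`. [folklore] -/
private def paramA (k : ℕ) : Finset (ZMod (2 ^ k)) := ((evens k).erase 0).erase (((2 ^ k / 2 : ℕ) : ZMod (2 ^ k)))

/-- Parameters of the `β`-type multisets: `w ∈ 2ℤ/2ᵏ` with `2w ∉ {0, d}`. [folklore] -/
private def paramB (k : ℕ) : Finset (ZMod (2 ^ k)) :=
  ((evens k) \ fibreTwo 0) \ fibreTwo (((2 ^ k / 2 : ℕ) : ZMod (2 ^ k)))

/-- The fibre of `2c` is the progression `{c, c + d}`. [folklore] -/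
private theorem fibreTwo_val (hk : 0 < k) (c : ZMod (2 ^ k)) :
    (fibreTwo (((2 : ℕ) : ZMod (2 ^ k)) * c)).val = (Multiset.range 2).map (fun i : ℕ ↦ c + (i : ZMod (2 ^ k)) * 𝔢) :=
  filter_p_mul_eq_val Nat.prime_two hk c

/-- Membership in the fibre. [folklore] -/
private theorem mem_fibreTwo {w x : ZMod (2 ^ k)} : x ∈ fibreTwo w ↔ ((2 : ℕ) : ZMod (2 ^ k)) * x = w := by
  simp [fibreTwo]

/-- Fibres of multiplication by `2` over `2ℤ/2ᵏ` have two elements. [folklore] -/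
private theorem card_fibreTwo (hk : 0 < k) (c : ZMod (2 ^ k)) : (fibreTwo (((2 : ℕ) : ZMod (2 ^ k)) * c)).card = 2 := by
  rw [← Finset.card_val, fibreTwo_val hk, Multiset.card_map, Multiset.card_range]

/-- Every `w ∈ 2ℤ/2ᵏ` is `2c`. [folklore] -/
private theorem exists_eq_two_mul {w : ZMod (2 ^ k)} (hw : 2 ∣ w.val) : ∃ c : ZMod (2 ^ k), ((2 : ℕ) : ZMod (2 ^ k)) * c = w := by
  obtain ⟨j, hj⟩ := hw
  exact ⟨(j : ZMod (2 ^ k)), by rw [← Nat.cast_mul, ← hj, ZMod.natCast_zmod_val]⟩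

/-- `stdTwoA (2c) = σ_{2,c}`. [folklore] -/
private theorem stdTwoA_two_mul (hk : 0 < k) (c : ZMod (2 ^ k)) :
    stdTwoA (((2 : ℕ) : ZMod (2 ^ k)) * c) =
      (Multiset.range 2).map (fun i : ℕ ↦ c + (i : ZMod (2 ^ k)) * 𝔢) + {-(((2 : ℕ) : ZMod (2 ^ k)) * c)} + {𝔢} := by
  rw [stdTwoA, fibreTwo_val hk]

/-- `stdTwoB (2c)` is the multiset of values of `β_c`. [folklore] -/
private theorem stdTwoB_two_mul (hk : 0 < k) (c : ZMod (2 ^ k)) :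
    stdTwoB (((2 : ℕ) : ZMod (2 ^ k)) * c) =
      (Multiset.range 2).map (fun i : ℕ ↦ c + (i : ZMod (2 ^ k)) * 𝔢) + {𝔢 + 2 * c} + {-(4 * c)} := by
  rw [stdTwoB, fibreTwo_val hk]
  have e1 : ((2 : ℕ) : ZMod (2 ^ k)) * c + 𝔢 = 𝔢 + 2 * c := by
    push_cast
    ring
  have e2 : ((2 : ℕ) : ZMod (2 ^ k)) * (((2 : ℕ) : ZMod (2 ^ k)) * c) = 4 * c := by
    push_cast
    ring
  rw [e1, e2]

/-- Membership in `paramA`. [folklore] -/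
private theorem mem_paramA {w : ZMod (2 ^ k)} : w ∈ paramA k ↔ 2 ∣ w.val ∧ w ≠ 0 ∧ w ≠ 𝔢 := by
  simp only [paramA, evens, Finset.mem_erase, Finset.mem_filter, Finset.mem_univ, true_and]
  tauto

/-- Membership in `paramB`. [folklore] -/
private theorem mem_paramB {w : ZMod (2 ^ k)} :
    w ∈ paramB k ↔ 2 ∣ w.val ∧ ((2 : ℕ) : ZMod (2 ^ k)) * w ≠ 0 ∧ ((2 : ℕ) : ZMod (2 ^ k)) * w ≠ 𝔢 := by
  simp only [paramB, evens, fibreTwo, Finset.mem_sdiff, Finset.mem_filter, Finset.mem_univ, true_and]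
  tauto

/-- `|2ℤ/2ᵏ ∖ {0, d}| = 2ᵏ/2 − 2` (`k ≥ 2`). [folklore] -/
private theorem card_paramA (hk : 2 ≤ k) : (paramA k).card = 2 ^ k / 2 - 2 := by
  have hk0 : 0 < k := by omega
  have hd : 2 * (2 ^ k / 2) = 2 ^ k := Nat.mul_div_cancel' (dvd_pow_self 2 hk0.ne')
  have h4 : 4 ∣ 2 ^ k := by
    have := pow_dvd_pow 2 hk
    simpa using this
  have hde : (𝔢 : ZMod (2 ^ k)) ≠ 0 := natCast_div_ne_zero Nat.prime_two hk0
  have hdval : (𝔢 : ZMod (2 ^ k)).val = 2 ^ k / 2 := by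
    rw [ZMod.val_natCast, Nat.mod_eq_of_lt]
    have : 0 < 2 ^ k := by positivity
    omega
  have hmem_e : (𝔢 : ZMod (2 ^ k)) ∈ (evens k).erase 0 := by
    rw [Finset.mem_erase, evens, Finset.mem_filter]
    refine ⟨hde, Finset.mem_univ _, ?_⟩
    rw [hdval]
    omega
  have hmem_0 : (0 : ZMod (2 ^ k)) ∈ evens k := by
    simp [evens]
  rw [paramA, Finset.card_erase_of_mem hmem_e, Finset.card_erase_of_mem hmem_0, evens,
    card_filter_dvd_val Nat.prime_two hk0]
  omega

/-- `|{w ∈ 2ℤ/2ᵏ | 2w ∉ {0, d}}| = 2ᵏ/2 − 4` (`k ≥ 3`). [folklore] -/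
private theorem card_paramB (hk : 3 ≤ k) : (paramB k).card = 2 ^ k / 2 - 4 := by
  have hk0 : 0 < k := by omega
  have hd : 2 * (2 ^ k / 2) = 2 ^ k := Nat.mul_div_cancel' (dvd_pow_self 2 hk0.ne')
  have h8 : 8 ∣ 2 ^ k := by
    have := pow_dvd_pow 2 hk
    simpa using this
  have hpos : 0 < 2 ^ k := by positivity
  -- `d = 2 e'`, `e' = 2^k/4`
  set e' : ZMod (2 ^ k) := ((2 ^ k / 4 : ℕ) : ZMod (2 ^ k)) with he'
  have he'val : e'.val = 2 ^ k / 4 := by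
    rw [he', ZMod.val_natCast, Nat.mod_eq_of_lt]
    omega
  have h2e' : ((2 : ℕ) : ZMod (2 ^ k)) * e' = 𝔢 := by
    rw [he', ← Nat.cast_mul]
    congr 1
    omega
  have hdval : (𝔢 : ZMod (2 ^ k)).val = 2 ^ k / 2 := by
    rw [ZMod.val_natCast, Nat.mod_eq_of_lt]
    omega
  -- the two fibres
  have hF0 : fibreTwo (0 : ZMod (2 ^ k)) = fibreTwo (((2 : ℕ) : ZMod (2 ^ k)) * 0) := by rw [mul_zero]
  have hsub0 : fibreTwo (0 : ZMod (2 ^ k)) ⊆ evens k := by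
    intro x hx
    rw [mem_fibreTwo] at hx
    rw [evens, Finset.mem_filter]
    refine ⟨Finset.mem_univ _, ?_⟩
    rcases eq_zero_or_eq_e hk0 hx with h | h
    · rw [h, ZMod.val_zero]
      exact dvd_zero 2
    · rw [h, hdval]
      omega
  have hsubd : fibreTwo (𝔢 : ZMod (2 ^ k)) ⊆ evens k \ fibreTwo 0 := by
    intro x hx
    rw [mem_fibreTwo] at hx
    rw [Finset.mem_sdiff, evens, Finset.mem_filter, mem_fibreTwo]
    refine ⟨⟨Finset.mem_univ _, ?_⟩, ?_⟩
    · have h2 : ((2 : ℕ) : ZMod (2 ^ k)) * (x - e') = 0 := by rw [mul_sub, hx, h2e', sub_self]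
      rcases eq_zero_or_eq_e hk0 h2 with h | h
      · rw [sub_eq_zero.mp h, he'val]
        omega
      · have hx' : x = e' + 𝔢 := by rw [← h]; ring
        rw [hx', ZMod.val_add, he'val, hdval, Nat.mod_eq_of_lt (by omega)]
        omega
    · rw [hx]
      exact natCast_div_ne_zero Nat.prime_two hk0
  rw [paramB, Finset.card_sdiff_of_subset hsubd, Finset.card_sdiff_of_subset hsub0, ← h2e', card_fibreTwo hk0, hF0,
    card_fibreTwo hk0, evens, card_filter_dvd_val Nat.prime_two hk0]
  omega

/-- Members of the `α`-family: duplicate-free of cardinality `4`. [folklore] -/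
private theorem nodup_card_stdTwoA (hk : 0 < k) {w : ZMod (2 ^ k)} (hw : w ∈ paramA k) :
    (stdTwoA w).Nodup ∧ Multiset.card (stdTwoA w) = 4 := by
  classical
  rw [mem_paramA] at hw
  obtain ⟨hw2, hw0, hwd⟩ := hw
  obtain ⟨c, hpc⟩ := exists_eq_two_mul hw2
  have hne := neg_e hk
  have h2e := two_mul_e hk
  have hnot1 : -w ∉ (fibreTwo w).val := by
    rw [Finset.mem_val, mem_fibreTwo, mul_neg]
    intro h
    apply hw0
    apply eq_zero_of_coprime_mul (p := 2) (n := 3) (Nat.Coprime.pow_right k (by norm_num))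
    push_cast at h ⊢
    linear_combination -h
  have hnot2 : (𝔢 : ZMod (2 ^ k)) ∉ (fibreTwo w).val + {-w} := by
    rw [Multiset.mem_add, Finset.mem_val, mem_fibreTwo, Multiset.mem_singleton, h2e]
    rintro (h | h)
    · exact hw0 h.symm
    · apply hwd
      rw [← neg_neg w, ← h, hne]
  constructor
  · rw [stdTwoA, Multiset.Nodup.add_iff _ (Multiset.nodup_singleton _), Multiset.disjoint_singleton]
    · exact hnot2
    · rw [Multiset.Nodup.add_iff (Finset.nodup _) (Multiset.nodup_singleton _), Multiset.disjoint_singleton]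
      exact hnot1
  · rw [← hpc, stdTwoA_two_mul hk, Multiset.card_add, Multiset.card_add, Multiset.card_map, Multiset.card_range,
      Multiset.card_singleton, Multiset.card_singleton]

/-- Members of the `β`-family: duplicate-free of cardinality `4`. [folklore] -/
private theorem nodup_card_stdTwoB (hk : 0 < k) {w : ZMod (2 ^ k)} (hw : w ∈ paramB k) :
    (stdTwoB w).Nodup ∧ Multiset.card (stdTwoB w) = 4 := by
  classical
  rw [mem_paramB] at hw
  obtain ⟨hw2, h2w0, h2wd⟩ := hw
  obtain ⟨c, hpc⟩ := exists_eq_two_mul hw2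
  have hne := neg_e hk
  have h2e := two_mul_e hk
  have hw0 : w ≠ 0 := fun e ↦ h2w0 (by rw [e, mul_zero])
  have hnot1 : w + 𝔢 ∉ (fibreTwo w).val := by
    rw [Finset.mem_val, mem_fibreTwo, mul_add, h2e, add_zero]
    intro h
    apply hw0
    linear_combination h
  have hnot2 : -(((2 : ℕ) : ZMod (2 ^ k)) * w) ∉ (fibreTwo w).val + {w + 𝔢} := by
    rw [Multiset.mem_add, Finset.mem_val, mem_fibreTwo, Multiset.mem_singleton]
    rintro (h | h)
    · apply hw0
      apply eq_zero_of_coprime_mul (p := 2) (n := 5) (Nat.Coprime.pow_right k (by norm_num))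
      push_cast at h ⊢
      linear_combination -h
    · apply h2w0
      apply eq_zero_of_coprime_mul (p := 2) (n := 3) (Nat.Coprime.pow_right k (by norm_num))
      push_cast at h h2e ⊢
      linear_combination -2 * h - h2e
  constructor
  · rw [stdTwoB, Multiset.Nodup.add_iff _ (Multiset.nodup_singleton _), Multiset.disjoint_singleton]
    · exact hnot2
    · rw [Multiset.Nodup.add_iff (Finset.nodup _) (Multiset.nodup_singleton _), Multiset.disjoint_singleton]
      exact hnot1
  · rw [← hpc, stdTwoB_two_mul hk, Multiset.card_add, Multiset.card_add, Multiset.card_map, Multiset.card_range,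
      Multiset.card_singleton, Multiset.card_singleton]

/-- Injectivity of the `α`-family on its parameters. [folklore] -/
private theorem stdTwoA_injOn (hk : 0 < k) : Set.InjOn (stdTwoA (k := k)) (paramA k) := by
  classical
  intro w hw w' hw' h
  rw [Finset.mem_coe, mem_paramA] at hw hw'
  have hne := neg_e hk
  by_contra hww
  have mem1 : -w ∈ stdTwoA w' := by
    rw [← h, stdTwoA]
    exact Multiset.mem_add.mpr (Or.inl (Multiset.mem_add.mpr (Or.inr (Multiset.mem_singleton_self _))))
  have mem2 : -w' ∈ stdTwoA w := by
    rw [h, stdTwoA]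
    exact Multiset.mem_add.mpr (Or.inl (Multiset.mem_add.mpr (Or.inr (Multiset.mem_singleton_self _))))
  rw [stdTwoA, Multiset.mem_add, Multiset.mem_add, Finset.mem_val, mem_fibreTwo, Multiset.mem_singleton,
    Multiset.mem_singleton, neg_inj] at mem1 mem2
  rcases mem1 with (h1 | h1) | h1
  · rcases mem2 with (h2 | h2) | h2
    · apply hw.2.1
      apply eq_zero_of_coprime_mul (p := 2) (n := 3) (Nat.Coprime.pow_right k (by norm_num))
      push_cast at h1 h2 ⊢
      linear_combination -2 * h1 + h2
    · exact hww h2.symm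
    · apply hw'.2.2
      rw [← neg_neg w', h2, hne]
  · exact hww h1
  · apply hw.2.2
    rw [← neg_neg w, h1, hne]

/-- Injectivity of the `β`-family on its parameters. [folklore] -/
private theorem stdTwoB_injOn (hk : 0 < k) : Set.InjOn (stdTwoB (k := k)) (paramB k) := by
  classical
  intro w hw w' hw' h
  rw [Finset.mem_coe, mem_paramB] at hw hw'
  have hde : (𝔢 : ZMod (2 ^ k)) ≠ 0 := natCast_div_ne_zero Nat.prime_two hk
  have h2e := two_mul_e hk
  have hw0' : w' ≠ 0 := fun e ↦ hw'.2.1 (by rw [e, mul_zero])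
  by_contra hww
  obtain ⟨c, hpc⟩ := exists_eq_two_mul hw.1
  -- the fibre `{c, c + d}` of `w` lies in `stdTwoB w'` but misses the fibre of `w'`
  have memc : ∀ x, ((2 : ℕ) : ZMod (2 ^ k)) * x = w → x = w' + 𝔢 ∨ x = -(((2 : ℕ) : ZMod (2 ^ k)) * w') := by
    intro x hx
    have : x ∈ stdTwoB w' := by
      rw [← h, stdTwoB]
      exact Multiset.mem_add.mpr (Or.inl (Multiset.mem_add.mpr (Or.inl (by rw [Finset.mem_val, mem_fibreTwo, hx]))))
    rw [stdTwoB, Multiset.mem_add, Multiset.mem_add, Finset.mem_val, mem_fibreTwo, Multiset.mem_singleton,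
      Multiset.mem_singleton] at this
    rcases this with (h1 | h1) | h1
    · exact absurd (hx.symm.trans h1) hww
    · exact Or.inl h1
    · exact Or.inr h1
  have hc1 := memc c hpc
  have hc2 := memc (c + 𝔢) (by rw [mul_add, hpc, h2e, add_zero])
  rcases hc1 with h1 | h1 <;> rcases hc2 with h2 | h2
  · exact hde (by linear_combination h2 - h1)
  · apply hw0'
    apply eq_zero_of_coprime_mul (p := 2) (n := 3) (Nat.Coprime.pow_right k (by norm_num))
    push_cast at h1 h2 h2e ⊢
    linear_combination h2 - h1 - h2e
  · apply hw0'
    apply eq_zero_of_coprime_mul (p := 2) (n := 3) (Nat.Coprime.pow_right k (by norm_num))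
    push_cast at h1 h2 h2e ⊢
    linear_combination h1 - h2
  · exact hde (by linear_combination h2 - h1)

/-- The two families are disjoint (`d` belongs to every `α`-type multiset and to no `β`-type one). [folklore] -/
private theorem disjoint_images (hk : 0 < k) :
    Disjoint ((paramA k).image stdTwoA) ((paramB k).image stdTwoB) := by
  classical
  rw [Finset.disjoint_left]
  intro t ht ht'
  obtain ⟨w, hw, rfl⟩ := Finset.mem_image.mp ht
  obtain ⟨w', hw', h⟩ := Finset.mem_image.mp ht'
  rw [mem_paramB] at hw'
  have h2e := two_mul_e hk
  have hne := neg_e hk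
  have mem : (𝔢 : ZMod (2 ^ k)) ∈ stdTwoB w' := by
    rw [h, stdTwoA]
    exact Multiset.mem_add.mpr (Or.inr (Multiset.mem_singleton_self _))
  rw [stdTwoB, Multiset.mem_add, Multiset.mem_add, Finset.mem_val, mem_fibreTwo, Multiset.mem_singleton,
    Multiset.mem_singleton, h2e] at mem
  rcases mem with (h1 | h1) | h1
  · exact hw'.2.1 (by rw [← h1, mul_zero])
  · apply hw'.2.1
    have : w' = 0 := by linear_combination -h1
    rw [this, mul_zero]
  · apply hw'.2.2
    rw [← hne, h1, neg_neg]

/-- **`𝔍²ₘ` at `m = 2ᵏ` as a fibre of the multiset map** (Theorem 6 (c)). [cite: Shioda1982PicardFermat, Thm 6 (c) p. 731] -/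
private theorem indecomposableQuadruples_two_pow (hk : 0 < k) :
    indecomposableQuadruples (2 ^ k) =
      univ.filter fun α : Fin 4 → ZMod (2 ^ k) ↦
        univ.val.map α ∈ (paramA k).image stdTwoA ∪ (paramB k).image stdTwoB := by
  classical
  ext α
  rw [mem_indecomposableQuadruples, Finset.mem_filter, Finset.mem_union, Finset.mem_image, Finset.mem_image]
  simp only [Finset.mem_univ, true_and]
  constructor
  · rintro ⟨hα, hind⟩
    obtain ⟨c, h⟩ := map_eq_std_of_indecomposable_two hk hα hind
    rcases h with ⟨h0, hd, hs⟩ | ⟨h0, hd, hs⟩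
    · refine Or.inl ⟨((2 : ℕ) : ZMod (2 ^ k)) * c, ?_, ?_⟩
      · rw [mem_paramA]
        exact ⟨dvd_val_p_mul Nat.prime_two hk c, h0, hd⟩
      · rw [stdTwoA_two_mul hk, hs]
    · refine Or.inr ⟨((2 : ℕ) : ZMod (2 ^ k)) * c, ?_, ?_⟩
      · rw [mem_paramB]
        refine ⟨dvd_val_p_mul Nat.prime_two hk c, ?_, ?_⟩
        · rwa [Nat.cast_ofNat] at h0 ⊢
        · rwa [Nat.cast_ofNat] at hd ⊢
      · rw [stdTwoB_two_mul hk, hs]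
  · rintro (⟨w, hw, hαw⟩ | ⟨w, hw, hαw⟩)
    · rw [mem_paramA] at hw
      obtain ⟨hw2, hw0, hwd⟩ := hw
      obtain ⟨c, hpc⟩ := exists_eq_two_mul hw2
      rw [← hpc, stdTwoA_two_mul hk, ← univ_val_map_alphaStd] at hαw
      obtain ⟨σ, hσ⟩ := exists_perm_of_map_eq hαw.symm
      rw [Nat.cast_ofNat] at hpc
      refine (indecomposable_iff_two_pow hk α).mpr ⟨c, σ, Or.inl ⟨?_, ?_, fun i ↦ (congrFun hσ i).symm⟩⟩
      · rw [hpc]; exact hw0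
      · rw [hpc]; exact hwd
    · rw [mem_paramB] at hw
      obtain ⟨hw2, h2w0, h2wd⟩ := hw
      obtain ⟨c, hpc⟩ := exists_eq_two_mul hw2
      rw [← hpc, stdTwoB_two_mul hk, ← univ_val_map_betaStd] at hαw
      obtain ⟨σ, hσ⟩ := exists_perm_of_map_eq hαw.symm
      have e4 : (4 : ZMod (2 ^ k)) * c = ((2 : ℕ) : ZMod (2 ^ k)) * w := by
        rw [← hpc]
        push_cast
        ring
      refine (indecomposable_iff_two_pow hk α).mpr ⟨c, σ, Or.inr ⟨?_, ?_, fun i ↦ (congrFun hσ i).symm⟩⟩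
      · rw [e4]; exact h2w0
      · rw [e4]; exact h2wd

/-- **The number of indecomposable elements at level `2ᵏ`, `k ≥ 3`: `|𝔍²ₘ| = 24((m/2 − 2) + (m/2 − 4)) = 24(m − 6)`**
(`m/2 − 2` multisets of type `α`, `m/2 − 4` of type `β`, `4! = 24` orderings each; Shioda: `Σ_{d ∣ m, d<m} 24 g(m/d)` with
`g(2ʲ) = 2φ(2ʲ⁻¹) = 2ʲ⁻¹` for `j ≥ 4`, `g(8) = 2`, `g(4) = g(2) = 0`). [cite: Shioda1982PicardFermat, (5) p. 726 and Thm 8 (i) p. 732] -/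
theorem card_indecomposableQuadruples_two_pow (hk : 3 ≤ k) :
    (indecomposableQuadruples (2 ^ k)).card = 24 * (2 ^ k - 6) := by
  classical
  have hk0 : 0 < k := by omega
  have hd : 2 * (2 ^ k / 2) = 2 ^ k := Nat.mul_div_cancel' (dvd_pow_self 2 hk0.ne')
  have h8 : 8 ≤ 2 ^ k := by
    calc 8 = 2 ^ 3 := by norm_num
      _ ≤ 2 ^ k := Nat.pow_le_pow_right (by norm_num) hk
  rw [indecomposableQuadruples_two_pow hk0, card_filter_map_mem _ fun t ht ↦ ?_,
    Finset.card_union_of_disjoint (disjoint_images hk0), Finset.card_image_of_injOn (stdTwoA_injOn hk0),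
    Finset.card_image_of_injOn (stdTwoB_injOn hk0), card_paramA (by omega), card_paramB hk]
  · show Nat.factorial 4 * _ = _
    rw [show Nat.factorial 4 = 24 from rfl]
    omega
  · rcases Finset.mem_union.mp ht with ht | ht
    · obtain ⟨w, hw, rfl⟩ := Finset.mem_image.mp ht
      exact nodup_card_stdTwoA hk0 hw
    · obtain ⟨w, hw, rfl⟩ := Finset.mem_image.mp ht
      exact nodup_card_stdTwoB hk0 hw

/-- **Shioda 1982, Theorem 8 (i), `n ≥ 3`.** "If `m = 2ⁿ`, then `ρ(X²ₘ) = 3(m−1)(m−2) + 2 + 24(m−6)` (`n ≥ 3`)": combinatorial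
content `|𝔅²ₘ| = 3(m−1)(m−2) + 1 + 24(m−6)` for every `m = 2ᵏ`, `k ≥ 3` (`ρ = |𝔅²ₘ| + 1` by (1), Lefschetz, not formalised);
`|𝔇²ₘ| = 3(m−1)(m−2) + 1` by (3) (`m` even) and `|𝔍²ₘ| = 24(m−6)` by Theorem 6 (c). [cite: Shioda1982PicardFermat, Thm 8 (i) p. 732] -/
theorem card_hodgeQuadruples_two_pow (hk : 3 ≤ k) :
    (hodgeQuadruples (2 ^ k)).card = 3 * (2 ^ k - 1) * (2 ^ k - 2) + 1 + 24 * (2 ^ k - 6) := by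
  have heven : Even (2 ^ k) := (Nat.even_pow' (by omega : k ≠ 0)).mpr even_two
  rw [card_hodgeQuadruples_eq_add, card_decomposableQuadruples, if_pos heven, card_indecomposableQuadruples_two_pow hk]

/-- Theorem 8 (i), `n ≥ 3`, with the Lefschetz summand: `|𝔅²ₘ| + 1 = 3(m−1)(m−2) + 2 + 24(m−6)` (`= ρ(X²ₘ)` by (1)).
[cite: Shioda1982PicardFermat, Thm 8 (i) p. 732] -/
theorem card_hodgeQuadruples_two_pow_add_one (hk : 3 ≤ k) :
    (hodgeQuadruples (2 ^ k)).card + 1 = 3 * (2 ^ k - 1) * (2 ^ k - 2) + 2 + 24 * (2 ^ k - 6) := by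
  rw [card_hodgeQuadruples_two_pow hk]
  ring

/-- **Theorem 8 (i), the small cases `n = 1, 2`** (direct evaluation): `|𝔅²₂| = 1` and `|𝔅²₄| = 19`, i.e. `ρ(X²₂) = 2` and
`ρ(X²₄) = 20` — "(`= 20` if `n = 2` and `= 2` if `n = 1`)". [cite: Shioda1982PicardFermat, Thm 8 (i) p. 732] -/
theorem card_hodgeQuadruples_two_and_four :
    (hodgeQuadruples (2 ^ 1)).card + 1 = 2 ∧ (hodgeQuadruples (2 ^ 2)).card + 1 = 20 := by
  constructor <;> decide +kernel

/-- Kernel cross-check of Theorem 8 (i) at `m = 8`: direct evaluation of `𝔅²₈` gives the value of the closed formula,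
`|𝔅²₈| = 126 + 1 + 48 = 175`; the theorem gives e.g. `|𝔅²₁₆| = 871`, `|𝔅²₃₂| = 3415` without evaluation (the cell's
enumeration has `rank = 872, 3416` at `(m, n) = (16, 2), (32, 2)`). [cite: Shioda1982PicardFermat, Thm 8 (i) p. 732] -/
example : (hodgeQuadruples (2 ^ 3)).card = 3 * (2 ^ 3 - 1) * (2 ^ 3 - 2) + 1 + 24 * (2 ^ 3 - 6) := by
  decide +kernel

/-- `|𝔅²₁₆| = 871` and `|𝔅²₃₂| = 3415` by Theorem 8 (i). [cite: Shioda1982PicardFermat, Thm 8 (i) p. 732] -/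
example : (hodgeQuadruples (2 ^ 4)).card = 871 ∧ (hodgeQuadruples (2 ^ 5)).card = 3415 := by
  rw [card_hodgeQuadruples_two_pow (by norm_num), card_hodgeQuadruples_two_pow (by norm_num)]
  decide


/-- **Aoki–Shioda 1983, Theorem `(𝔅²ₘ)` (ii) at the levels `m = 2ᵏ`, in the letter of the tree's named fact
`Literature.AlgebraicGeometry.HodgeTheory.AokiShioda1983_thmB2m_standard`** (file `HodgeTheory/FermatSurfaceHodgeCharacterStructure`,
an unproved fact there for all `m > 180`, `(m, 6) > 1`): a primitive indecomposable `α ∈ 𝔅²_{2ᵏ}` is a permutation of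
a) `(i, d + i, −2i, d)` or b) `(i, d + i, d + 2i, −4i)`, `m = 2d`, `1 ≤ i < d`, `(i, d) = 1` (and `3i, 4i, 6i ≠ m`) — the body of that
fact at `m = 2ᵏ` (alternative c) needs `3 ∣ m`). PROOF: `exists_perm_alphaStd_or_betaStd_lt` (Theorem 6 (c) in the printed
normalisation, `i` odd); `4i ≠ m` because the first two entries of an indecomposable element do not cancel.
[cite: AokiShioda1983, §2 Theorem (𝔅²ₘ) (ii) a), b), p. 3] [cite: Shioda1982PicardFermat, Thm 6 (c) p. 731] -/
theorem thmB2m_standard_two_pow (hk : 0 < k) (α : Fin 4 → ZMod (2 ^ k)) (hα : IsHodge α)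
    (hind : ∀ i j : Fin 4, i ≠ j → α i + α j ≠ 0) (hprim : ∀ g : ℕ, (∀ i, g ∣ (α i).val) → g = 1) :
    ∃ σ : Equiv.Perm (Fin 4),
      (∃ d i : ℕ, 2 ^ k = 2 * d ∧ 1 ≤ i ∧ i < d ∧ Nat.Coprime i d ∧ 4 * i ≠ 2 ^ k ∧
          ∀ l, α (σ l) = ![(i : ZMod (2 ^ k)), (d : ZMod (2 ^ k)) + i, -(2 * (i : ZMod (2 ^ k))), (d : ZMod (2 ^ k))] l) ∨
      (∃ d i : ℕ, 2 ^ k = 2 * d ∧ 1 ≤ i ∧ i < d ∧ Nat.Coprime i d ∧ 3 * i ≠ 2 ^ k ∧ 4 * i ≠ 2 ^ k ∧ 6 * i ≠ 2 ^ k ∧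
          ∀ l, α (σ l) =
            ![(i : ZMod (2 ^ k)), (d : ZMod (2 ^ k)) + i, (d : ZMod (2 ^ k)) + 2 * i, -(4 * (i : ZMod (2 ^ k)))] l) ∨
      (∃ d j : ℕ, 2 ^ k = 3 * d ∧ 1 ≤ j ∧ j < d ∧ Nat.Coprime j d ∧ 6 * j ≠ 2 ^ k ∧
          ∀ l, α (σ l) =
            ![(j : ZMod (2 ^ k)), (d : ZMod (2 ^ k)) + j, 2 * (d : ZMod (2 ^ k)) + j, -(3 * (j : ZMod (2 ^ k)))] l) := by
  classical
  obtain ⟨i, σ, hi1, hid, hi2, h⟩ := exists_perm_alphaStd_or_betaStd_lt hk hα hind hprim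
  have hd2 : 2 * (2 ^ k / 2) = 2 ^ k := Nat.mul_div_cancel' (dvd_pow_self 2 hk.ne')
  have hcop2k : Nat.Coprime i (2 ^ k) :=
    Nat.Coprime.pow_right k ((Nat.Prime.coprime_iff_not_dvd Nat.prime_two).2 hi2).symm
  have hcop : Nat.Coprime i (2 ^ k / 2) :=
    Nat.Coprime.coprime_dvd_right (Nat.div_dvd_of_dvd (dvd_pow_self 2 hk.ne')) hcop2k
  have h3 : Nat.Coprime 3 (2 ^ k) := Nat.Coprime.pow_right k (by norm_num)
  have h3i : 3 * i ≠ 2 ^ k := fun e ↦ by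
    have := h3.eq_one_of_dvd ⟨i, e.symm⟩
    omega
  have h6i : 6 * i ≠ 2 ^ k := fun e ↦ by
    have := h3.eq_one_of_dvd ⟨2 * i, by omega⟩
    omega
  -- `4i ≠ m`: otherwise the first two entries `i`, `d + i` of `α_i` / `β_i` would cancel (`d + 2i = 2d = 0`)
  have h01 : α (σ 0) + α (σ 1) = 𝔢 + 2 * (i : ZMod (2 ^ k)) := by
    rcases h with h | h <;> rw [h 0, h 1] <;>
      simp only [alphaStd, betaStd, Matrix.cons_val_zero, Matrix.cons_val_one] <;> ring
  have h4i : 4 * i ≠ 2 ^ k := fun e ↦ by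
    have h2i : 2 * i = 2 ^ k / 2 := by omega
    have hd : (2 : ZMod (2 ^ k)) * 𝔢 = 0 := by
      have := two_mul_e (k := k) hk
      rwa [Nat.cast_ofNat] at this
    have hsum : α (σ 0) + α (σ 1) = 0 := by
      rw [h01, show (2 : ZMod (2 ^ k)) * (i : ZMod (2 ^ k)) = 𝔢 by rw [← h2i, Nat.cast_mul, Nat.cast_ofNat]]
      linear_combination hd
    exact hind (σ 0) (σ 1) (σ.injective.ne (by decide)) hsum
  refine ⟨σ, ?_⟩
  rcases h with h | h
  · exact Or.inl ⟨2 ^ k / 2, i, hd2.symm, hi1, hid, hcop, h4i, fun l ↦ by rw [h l]; rfl⟩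
  · exact Or.inr (Or.inl ⟨2 ^ k / 2, i, hd2.symm, hi1, hid, hcop, h3i, h4i, h6i, fun l ↦ by rw [h l]; rfl⟩)

end TwoPow


/-! ## Level `m = 5ⁿ`: the Hodge sextuples (Shioda 1981, Appendix, for `m = 25`) -/

section FivePow

variable {k : ℕ}

/-- `d = m/5` as a residue modulo `m = 5ᵏ`. -/
local notation "𝔣" => (((5 ^ k / 5 : ℕ) : ZMod (5 ^ k)))

/-- **Shioda's `γᵢ = (i, i+5, i+10, i+15, i+20, 25 − 5i)`** (Math. Ann. 258, Appendix (A.1), at `m = 25`) = Aoki's `5`-standard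
element `σ_{5,i} = (i, d+i, 2d+i, 3d+i, 4d+i, m − 5i)`, `d = m/5`, here at every level `m = 5ᵏ` and for an arbitrary residue `i = c`.
[cite: Shioda1981FermatType, Appendix (A.1), p. 78] [cite: Aoki1987, §1 p. 387 (σ_{p,i})] -/
def fiveStd (c : ZMod (5 ^ k)) : Fin 6 → ZMod (5 ^ k) := ![c, 𝔣 + c, 2 * 𝔣 + c, 3 * 𝔣 + c, 4 * 𝔣 + c, -(5 * c)]

/-- The multiset of values of `γ_c` is `σ_{5,c} = {c + i d}_{i<5} + {−5c}` (the tree's spelling). [cite: Shioda1981FermatType, Appendix (A.1), p. 78] -/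
theorem univ_val_map_fiveStd (c : ZMod (5 ^ k)) :
    univ.val.map (fiveStd c) =
      (Multiset.range 5).map (fun i : ℕ ↦ c + (i : ZMod (5 ^ k)) * 𝔣) + {-(((5 : ℕ) : ZMod (5 ^ k)) * c)} := by
  have e1 : univ.val.map (fiveStd c) = {c, 𝔣 + c, 2 * 𝔣 + c, 3 * 𝔣 + c, 4 * 𝔣 + c, -(5 * c)} := by
    simp [fiveStd, Fin.univ_val_map]
    rfl
  have e2 : (Multiset.range 5).map (fun i : ℕ ↦ c + (i : ZMod (5 ^ k)) * 𝔣) =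
      {4 * 𝔣 + c, 3 * 𝔣 + c, 2 * 𝔣 + c, 𝔣 + c, c} := by
    simp [Multiset.range_succ, add_comm, mul_comm]
  rw [e1, e2, Nat.cast_ofNat]
  simp only [Multiset.insert_eq_cons, ← Multiset.singleton_add]
  abel

/-- **`γ_c ∈ 𝔅⁴ₘ`** (`m = 5ᵏ`, `5c ≠ 0`). [cite: Shioda1981FermatType, Appendix (A.1), p. 78] [cite: Aoki1987, §1 p. 387] -/
theorem isHodge_fiveStd (hk : 0 < k) {c : ZMod (5 ^ k)} (hc : 5 * c ≠ 0) : IsHodge (fiveStd c) := by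
  rw [isHodge_iff_isHodgeMultiset, univ_val_map_fiveStd]
  have hc' : ((5 : ℕ) : ZMod (5 ^ k)) * c ≠ 0 := by rwa [Nat.cast_ofNat]
  have h := isHodgeMultiset_std (p := 5) Nat.prime_five hk hc'
  rwa [if_neg (by norm_num : (5 : ℕ) ≠ 2), add_zero] at h

/-- A paired character has symmetric multiplicities. [folklore] -/
private theorem count_eq_count_neg_of_isPaired {m r : ℕ} {α : Fin r → ZMod m} (h : IsPaired α) (x : ZMod m) :
    count x (univ.val.map α) = count (-x) (univ.val.map α) := by
  classical
  obtain ⟨σ, -, -, hσ⟩ := h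
  rw [count_univ_val_map, count_univ_val_map]
  refine Finset.card_bij (fun i _ ↦ σ i) (fun i hi ↦ ?_) (fun i _ j _ hij ↦ σ.injective hij) (fun j hj ↦ ?_)
  · simp only [Finset.mem_filter, Finset.mem_univ, true_and] at hi ⊢
    rw [hσ, hi]
  · simp only [Finset.mem_filter, Finset.mem_univ, true_and] at hj
    refine ⟨σ.symm j, ?_, by simp⟩
    simp only [Finset.mem_filter, Finset.mem_univ, true_and]
    have := hσ (σ.symm j)
    rw [Equiv.apply_symm_apply] at this
    rw [← neg_neg x, ← hj, this, neg_neg]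

/-- At level `5ᵏ` (odd), a Hodge sextuple is paired iff its multiplicities are symmetric. [folklore] -/
private theorem isPaired_iff_symmetric (hk : 0 < k) {α : Fin 6 → ZMod (5 ^ k)} (hα : IsHodge α) :
    IsPaired α ↔ ∀ x, count x (univ.val.map α) = count (-x) (univ.val.map α) := by
  classical
  refine ⟨count_eq_count_neg_of_isPaired, fun h ↦ isPaired_of_card_filter_eq (fun i e ↦ ?_) fun x ↦ ?_⟩
  · have := (eq_half_of_eq_neg (p := 5) Nat.prime_five hk e (hα.1.1 i)).1
    norm_num at this
  · rw [← count_univ_val_map, ← count_univ_val_map, h]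

/-- **Shioda 1981, Appendix: the Hodge sextuples of level `5ᵏ`.** Every Hodge character `α ∈ 𝔅⁴ₘ`, `m = 5ᵏ` (`k ≥ 1`), is either
paired (a juxtaposition of three pairs `(a, −a)`; at `m = 25` these are the printed "`182400` decomposable elements") or a
permutation of a standard sextuple `γ_c = σ_{5,c}`, `5c ≠ 0`.
Printed at `m = 25`: "the set `𝔅⁴₂₅` has `4·6!` indecomposable elements which are permutations of `γᵢ` (`1 ≤ i ≤ 4`) and `182400`
decomposable elements" (p. 79); the statement for all `k` is this formalisation's (`eq_pStandard_of_not_symmetric`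
at `p = 5`). [cite: Shioda1981FermatType, Appendix (A.1), pp. 78–79] -/
theorem isPaired_or_exists_perm_fiveStd (hk : 0 < k) {α : Fin 6 → ZMod (5 ^ k)} (hα : IsHodge α) :
    IsPaired α ∨ ∃ (c : ZMod (5 ^ k)) (σ : Equiv.Perm (Fin 6)), 5 * c ≠ 0 ∧ ∀ i, α (σ i) = fiveStd c i := by
  classical
  by_cases hsym : ∀ x, count x (univ.val.map α) = count (-x) (univ.val.map α)
  · exact Or.inl ((isPaired_iff_symmetric hk hα).mpr hsym)
  · right
    push Not at hsym
    have hcard : Multiset.card (univ.val.map α) = 5 + 1 := by simp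
    obtain ⟨c, hc, hsc⟩ :=
      eq_pStandard_of_not_symmetric (p := 5) Nat.prime_five (by norm_num) hk hα.isHodgeMultiset hcard hsym
    rw [← univ_val_map_fiveStd] at hsc
    obtain ⟨σ, hσ⟩ := exists_perm_of_map_eq hsc
    exact ⟨c, σ, by rwa [Nat.cast_ofNat] at hc, fun i ↦ (congrFun hσ i).symm⟩

/-- **Characterisation**: at `m = 5ᵏ`, the non-paired elements of `𝔅⁴ₘ` are exactly the permutations of the `γ_c`, `5c ≠ 0`.
[cite: Shioda1981FermatType, Appendix (A.1), pp. 78–79] -/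
theorem not_isPaired_iff_five_pow (hk : 0 < k) (α : Fin 6 → ZMod (5 ^ k)) :
    (IsHodge α ∧ ¬ IsPaired α) ↔
      ∃ (c : ZMod (5 ^ k)) (σ : Equiv.Perm (Fin 6)), 5 * c ≠ 0 ∧ ∀ i, α (σ i) = fiveStd c i := by
  classical
  constructor
  · rintro ⟨hα, hnp⟩
    rcases isPaired_or_exists_perm_fiveStd hk hα with h | h
    · exact absurd h hnp
    · exact h
  · rintro ⟨c, σ, hc, h⟩
    have e : α = fiveStd c ∘ σ.symm := by
      funext j
      rw [Function.comp_apply, ← h (σ.symm j), Equiv.apply_symm_apply]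
    have hα : IsHodge α := e ▸ (isHodge_fiveStd hk hc).compEquiv σ.symm
    refine ⟨hα, fun hp ↦ ?_⟩
    have hsym := (isPaired_iff_symmetric hk hα).mp hp c
    have hmap : univ.val.map α = univ.val.map (fiveStd c) := by
      have hσmap : (univ : Finset (Fin 6)).val.map (⇑σ.symm) = (univ : Finset (Fin 6)).val := by
        have h' := congrArg Finset.val (Finset.map_univ_equiv σ.symm)
        rwa [Finset.map_val, Equiv.coe_toEmbedding] at h'
      rw [e, ← Multiset.map_map, hσmap]
    have hc' : ((5 : ℕ) : ZMod (5 ^ k)) * c ≠ 0 := by rwa [Nat.cast_ofNat]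
    have h12 := count_std_self_and_neg (p := 5) Nat.prime_five (by norm_num) hk hc'
    rw [← univ_val_map_fiveStd, ← hmap] at h12
    omega

open scoped Classical in
/-- **The number of non-paired Hodge sextuples at level `5ᵏ`: `6! · (m/5 − 1)`.** [cite: Shioda1981FermatType, Appendix (A.1), pp. 78–79] -/
theorem card_hodge_not_paired_five_pow (hk : 0 < k) :
    (univ.filter fun α : Fin 6 → ZMod (5 ^ k) ↦ IsHodge α ∧ ¬ IsPaired α).card = 720 * (5 ^ k / 5 - 1) := by
  classical
  have e : (univ.filter fun α : Fin 6 → ZMod (5 ^ k) ↦ IsHodge α ∧ ¬ IsPaired α) =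
      univ.filter fun α : Fin (5 + 1) → ZMod (5 ^ k) ↦ IsHodge α ∧
        ¬ ∀ x, count x (univ.val.map α) = count (-x) (univ.val.map α) := by
    ext α
    simp only [Finset.mem_filter, Finset.mem_univ, true_and]
    constructor
    · rintro ⟨hα, h⟩
      exact ⟨hα, fun hs ↦ h ((isPaired_iff_symmetric hk hα).mpr hs)⟩
    · rintro ⟨hα, h⟩
      exact ⟨hα, fun hp ↦ h ((isPaired_iff_symmetric hk hα).mp hp)⟩
  rw [e, card_hodge_not_symmetric_prime_pow (p := 5) Nat.prime_five (by norm_num) hk]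
  rfl

open scoped Classical in
/-- **Shioda 1981, p. 79: "`𝔅⁴₂₅` has `4·6!` indecomposable elements"** — at `m = 25` the non-paired Hodge sextuples number
`2880 = 4·6!` (the "`2880` Hodge classes on `X⁴₂₅`" outside the reach of the 1979 method; the count `182400` of the paired ones
is not formalised). [cite: Shioda1981FermatType, Appendix (A.1), pp. 78–79] -/
theorem card_hodge_not_paired_twentyfive :
    (univ.filter fun α : Fin 6 → ZMod (5 ^ 2) ↦ IsHodge α ∧ ¬ IsPaired α).card = 4 * Nat.factorial 6 ∧ 4 * Nat.factorial 6 = 2880 := by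
  refine ⟨?_, by decide⟩
  rw [card_hodge_not_paired_five_pow (by norm_num)]
  decide

end FivePow


end Literature.AlgebraicGeometry.Shioda1982
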